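import Literature.NumberTheory.LFunctions.PerronTruncatedBounded
import Literature.NumberTheory.LFunctions.HuxleyLargeValuesFourthMomentProofs
import Literature.NumberTheory.LFunctions.HuxleyLargeValuesProofs
import Literature.NumberTheory.LFunctions.ZetaOneLineBounds
import Literature.NumberTheory.LFunctions.HalaszMontgomeryInequality
import Literature.Analysis.Complex.RectangleCauchyFormula
import Mathlib.NumberTheory.Harmonic.ZetaAsymp
import HarnessLib

/-!
# Jutila's mean value lemma for zeta sums over well-spaced points (Jutila 1977, Lemma 3, (2.2), `q = 1`)

LABEL (line 1 of every C4 file): **NOT RH-BEARING** — a mean-value lemma for the partial sums of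
`ζ` at well-spaced points; the large-values and zero-density theorems such lemmas feed COUNT zeros
off the critical line, they never empty the strip (`Literature.Barriers.RiemannHypothesis.LindelofBacklund`).
RH-free literature; nothing in this file bears on the truth of RH.

Topic `NumberTheory/LFunctions`, cell rh-crit / corpus C4 (Guth–Maynard 2026 and its inputs).
M. Jutila, *Zero-density estimates for `L`-functions*, Acta Arith. 32 (1977) 55–62, §2, **Lemma 3**,
estimate **(2.2)** in the case (i) of a single modulus, here `q = 1` (all characters trivial):
"`∑_{r=1}^{R} |∑_{n=1}^{N} χ_r(n) n^{−1/2+it_r}|² ≪ (N + (RTq)^{1/2}) log^B(qT)`" for `|t_r| ≤ T`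
(`T ≥ 2`), `|t_r − t_s| ≥ 1` (`r ≠ s`), any positive integer `N`; "in this case the estimate
(2.2) is an easy consequence of the discrete analogue of the estimate (2.4)
`∑_χ ∫_{−T}^{T} |L(1/2+it, χ)|⁴ dt ≪ qT log^B(qT)`" (Jutila p. 59). The tree lacks this
discrete mean value (it has the Halász–Montgomery form `(N + R T^{1/2})`,
`Literature.NumberTheory.LFunctions.MatomakiRadziwill2016_lemma9_holds`, and Ivić's Theorem 5.3,
`ZetaM4D.sum_norm_sq_dirichletPoly_le_pos`, but not the fourth-moment form with `(RT)^{1/2}`).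

## Main statement (proved; no definition, no named fact is introduced)

* `JutilaMeanValue.sum_norm_sq_zetaSum_le` — in the `σ = 0` normalisation (the one consumed by
  Guth–Maynard-type arguments, where the dual sum `D_M(θ) = ∑_{m≤M} m^{−iθ}` of the approximate
  functional equation carries a prefactor `|θ|^{−1/2}` instead of the weights `n^{−1/2}`): there is
  an absolute `C` with
  `∑_{t∈𝒯} |∑_{n=1}^{L} n^{−it}|² ≤ C · L · (L + (#𝒯·T)^{1/2}) · log⁵ T`
  for all `L ≥ 1`, `T ≥ 2` and every finite `1`-separated `𝒯 ⊂ [−T, T]` (the factor `L` in front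
  is the `σ = 1/2 → σ = 0` renormalisation of Jutila's `N + (RT)^{1/2}`; the printed unspecified
  `log^B` is made explicit as `log⁵`, from Huxley's discrete fourth moment `≪ T log⁵ T`).

## The proof (Jutila's route, p. 59, with the tree's tools) and the auxiliary results

* §1 `sum_pairs_norm_sq_le` — Jutila's **Lemma 2** (p. 58), the majorant principle over pairs:
  `∑_{r,s}|∑_n a_n z_{rn}\bar z_{sn}|² ≤ A²∑_{r,s}|∑_n z_{rn}\bar z_{sn}|²` for `|a_n| ≤ A`
  (general index types; proved as printed: "the left-hand side is `∑_{m,n} a_m\bar a_n|∑_r z_{rm}\bar z_{rn}|²`").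
* §2 counting on `1`-separated sets (`∑_t 1/(1+t²) ≤ 8`, at most two points in `(−1,1)`);
  §3 `L(n ↦ n^{−it}, s) = ζ(s + it)`; §4 `‖ζ(σ+iθ)‖ ≤ 31|θ|^{1/2}(1+log|θ|)` on `σ ≥ 1/2`, `|θ| ≥ 3`
  (tree: `HuxleyLV.norm_zeta_le_rpow_log`, `ZetaOneLine.norm_riemannZeta_le_log`).
* §5 the discrete fourth and second moments of `ζ(1/2 + i(t+y))` over the SHIFTED points `t + y`
  (`t ∈ 𝒯`), from the named fact `Huxley1972_fourthMoment_discrete` DISCHARGED in the tree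
  (`Huxley1972_fourthMoment_discrete_holds`) and `HuxleyLV.norm_zeta_le_sixteen` for `|t+y| < 1`.
* §6 the "integral representation" step: the truncated Perron formula for `∑_{n≤L} n^{−it}`
  (`PerronBounded.exists_norm_perron_bounded_sub_le`, `x = L + 1/2`, `c = 1 + 1/log x`), the shift
  of the segment `Re w = c` to `Re w = 1/2` across the pole `w = 1 − it` of `ζ(w + it)` (residue
  `x^{1−it}/(1−it)`) by Cauchy's formula on a rectangle
  (`Literature.Analysis.Complex.integral_boundary_rect_div_sub_eq` applied to Mathlib's entire
  `riemannZeta₁`), and the bounds for the three remaining sides; `integral_inv_norm_le`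
  (`∫_{−T₃}^{T₃} dy/|1/2+iy| ≤ 4 log 3T₃`, via `arsinh`).
* §7 assembly: Cauchy–Schwarz in the height (`sq_integral_div_le`, from
  `ZetaM4D.integral_mul_sq_le`), the regimes `L ≥ T` (van der Corput bound for the kernel,
  `HalaszMontgomery.norm_kernel_le_vdc_abs`), `L ≤ 2` (trivial) and `3 ≤ L < T` (Perron), the
  latter split into `regime3_analytic` (analysis) and `regime3_numerics` (real arithmetic).

Deviations from the letter of the source (recorded, not gaps): `q = 1` only
-- TODO(general form): Dirichlet characters to a common modulus `q` and case (ii) (2.3), conductor `≤ Q`;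
the `σ = 0` normalisation instead of `n^{−1/2+it}` (equivalent up to the factor `N` by partial
summation); `B = 5`; the constant `C` is not optimised (numerals such as `2600000` are crude).

## References

* M. Jutila, *Zero-density estimates for L-functions*, Acta Arith. 32 (1977) 55–62, §2 Lemma 2,
  Lemma 3 (2.2)/(2.4), and p. 59 (the integral representation). [`Jutila1977`]
* H. L. Montgomery, R. C. Vaughan, *Multiplicative Number Theory I*, CUP 2007, Cor. 5.3 (truncated
  Perron). [`MontgomeryVaughan2007`]
* M. N. Huxley, *The Distribution of Prime Numbers*, Oxford 1972, Ch. 22 (22.22) (discrete fourth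
  moment). [`Huxley1972`]; A. Ivić, *The Riemann Zeta-Function*, Wiley 1985, (8.26). [`Ivic1985`]
-/

noncomputable section

open Real Set Filter Topology Complex MeasureTheory Finset
open scoped ComplexConjugate

namespace Literature.NumberTheory.LFunctions

namespace JutilaMeanValue

/-! ## §1. Jutila's Lemma 2: the majorant principle over pairs of points -/

/-- The expansion behind Jutila's Lemma 2: for any coefficients `c_n`,
`∑_{r,s} |∑_n c_n z_{rn} \bar z_{sn}|² = ∑_{m,n} c_m \bar c_n |∑_r z_{rm} \bar z_{rn}|²`
(as complex numbers). [cite: Jutila1977, proof of Lemma 2, p. 58] -/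
theorem sum_pairs_norm_sq_eq {ι κ : Type*} (P : Finset ι) (S : Finset κ) (c : κ → ℂ)
    (z : ι → κ → ℂ) :
    (((∑ r ∈ P, ∑ s ∈ P, ‖∑ n ∈ S, c n * (z r n * conj (z s n))‖ ^ 2 : ℝ)) : ℂ) =
      ∑ m ∈ S, ∑ n ∈ S, c m * conj (c n) *
        (((‖∑ r ∈ P, z r m * conj (z r n)‖ ^ 2 : ℝ)) : ℂ) := by
  -- pass to sums over the product sets `P × P` and `S × S`
  rw [← Finset.sum_product' (f := fun r s ↦ ‖∑ n ∈ S, c n * (z r n * conj (z s n))‖ ^ 2),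
    ← Finset.sum_product' (f := fun m n ↦ c m * conj (c n) *
      (((‖∑ r ∈ P, z r m * conj (z r n)‖ ^ 2 : ℝ)) : ℂ)), Complex.ofReal_sum]
  have h1 : ∀ p ∈ P ×ˢ P, (((‖∑ n ∈ S, c n * (z p.1 n * conj (z p.2 n))‖ ^ 2 : ℝ)) : ℂ) =
      ∑ q ∈ S ×ˢ S, c q.1 * conj (c q.2) *
        (z p.1 q.1 * conj (z p.1 q.2) * conj (z p.2 q.1 * conj (z p.2 q.2))) := by
    intro p _
    push_cast
    rw [← Complex.mul_conj', map_sum, Finset.sum_mul_sum, ← Finset.sum_product']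
    refine Finset.sum_congr rfl fun q _ ↦ ?_
    simp only [map_mul, Complex.conj_conj]
    ring
  have h2 : ∀ q ∈ S ×ˢ S, (((‖∑ r ∈ P, z r q.1 * conj (z r q.2)‖ ^ 2 : ℝ)) : ℂ) =
      ∑ p ∈ P ×ˢ P, z p.1 q.1 * conj (z p.1 q.2) * conj (z p.2 q.1 * conj (z p.2 q.2)) := by
    intro q _
    push_cast
    rw [← Complex.mul_conj', map_sum, Finset.sum_mul_sum, ← Finset.sum_product']
  have eR : (∑ q ∈ S ×ˢ S, c q.1 * conj (c q.2) *
      (((‖∑ r ∈ P, z r q.1 * conj (z r q.2)‖ ^ 2 : ℝ)) : ℂ)) =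
      ∑ q ∈ S ×ˢ S, ∑ p ∈ P ×ˢ P, c q.1 * conj (c q.2) *
        (z p.1 q.1 * conj (z p.1 q.2) * conj (z p.2 q.1 * conj (z p.2 q.2))) :=
    Finset.sum_congr rfl (fun q hq ↦ by rw [h2 q hq, Finset.mul_sum])
  rw [Finset.sum_congr rfl h1, eR]
  exact Finset.sum_comm

/-- **Jutila 1977, Lemma 2 (the general inequality in its proof).** For complex `a_n` with
`|a_n| ≤ A` and any complex matrix `(z_{rn})`,
`∑_{r,s} |∑_n a_n z_{rn} \bar z_{sn}|² ≤ A² ∑_{r,s} |∑_n z_{rn} \bar z_{sn}|²`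
("for the proof of this note that the left-hand side is
`∑_{m,n} a_m \bar a_n |∑_r z_{rm} \bar z_{rn}|² ≤ A² ∑_{m,n} |∑_r …|²"); arbitrary finite index
sets for `r, s` and for `n`, no sign hypothesis on `A` (for empty `S` both sides vanish).
[cite: Jutila1977, Lemma 2 and its proof, p. 58] -/
theorem sum_pairs_norm_sq_le {ι κ : Type*} (P : Finset ι) (S : Finset κ) (a : κ → ℂ)
    (z : ι → κ → ℂ) {A : ℝ} (ha : ∀ n ∈ S, ‖a n‖ ≤ A) :
    ∑ r ∈ P, ∑ s ∈ P, ‖∑ n ∈ S, a n * (z r n * conj (z s n))‖ ^ 2 ≤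
      A ^ 2 * ∑ r ∈ P, ∑ s ∈ P, ‖∑ n ∈ S, z r n * conj (z s n)‖ ^ 2 := by
  set g : κ → κ → ℝ := fun m n ↦ ‖∑ r ∈ P, z r m * conj (z r n)‖ ^ 2 with hg
  have hL : ((∑ r ∈ P, ∑ s ∈ P, ‖∑ n ∈ S, a n * (z r n * conj (z s n))‖ ^ 2 : ℝ) : ℂ) =
      ∑ m ∈ S, ∑ n ∈ S, a m * conj (a n) * ((g m n : ℝ) : ℂ) := sum_pairs_norm_sq_eq P S a z
  have hR : ((∑ r ∈ P, ∑ s ∈ P, ‖∑ n ∈ S, z r n * conj (z s n)‖ ^ 2 : ℝ) : ℂ) =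
      ∑ m ∈ S, ∑ n ∈ S, ((g m n : ℝ) : ℂ) := by
    have h := sum_pairs_norm_sq_eq P S (fun _ ↦ (1 : ℂ)) z
    simp only [one_mul, map_one, mul_one] at h
    exact h
  have hR' : (∑ r ∈ P, ∑ s ∈ P, ‖∑ n ∈ S, z r n * conj (z s n)‖ ^ 2 : ℝ) =
      ∑ m ∈ S, ∑ n ∈ S, g m n := by exact_mod_cast hR
  rw [hR']
  calc (∑ r ∈ P, ∑ s ∈ P, ‖∑ n ∈ S, a n * (z r n * conj (z s n))‖ ^ 2 : ℝ)
      = ‖((∑ r ∈ P, ∑ s ∈ P, ‖∑ n ∈ S, a n * (z r n * conj (z s n))‖ ^ 2 : ℝ) : ℂ)‖ := by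
        rw [Complex.norm_real, Real.norm_of_nonneg (by positivity)]
    _ = ‖∑ m ∈ S, ∑ n ∈ S, a m * conj (a n) * ((g m n : ℝ) : ℂ)‖ := by rw [hL]
    _ ≤ ∑ m ∈ S, ∑ n ∈ S, ‖a m * conj (a n) * ((g m n : ℝ) : ℂ)‖ :=
        (norm_sum_le _ _).trans (Finset.sum_le_sum fun m _ ↦ norm_sum_le _ _)
    _ ≤ ∑ m ∈ S, ∑ n ∈ S, A * A * g m n := by
        refine Finset.sum_le_sum fun m hm ↦ Finset.sum_le_sum fun n hn ↦ ?_
        rw [norm_mul, norm_mul, Complex.norm_conj, Complex.norm_real,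
          Real.norm_of_nonneg (by positivity)]
        have hg0 : 0 ≤ g m n := by positivity
        exact mul_le_mul_of_nonneg_right
          (mul_le_mul (ha m hm) (ha n hn) (norm_nonneg _) ((norm_nonneg _).trans (ha m hm))) hg0
    _ = A ^ 2 * ∑ m ∈ S, ∑ n ∈ S, g m n := by
        rw [Finset.mul_sum]; refine Finset.sum_congr rfl fun m _ ↦ ?_
        rw [Finset.mul_sum]; refine Finset.sum_congr rfl fun n _ ↦ ?_; ring

/-! ## §2. Counting lemmas for `1`-separated sets of reals -/

/-- On a `1`-separated set of reals, `∑_t 1/(1 + t²) ≤ 8` (compare each term with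
`(5/2) ∫_{t−1/2}^{t+1/2} du/(1+u²)` over disjoint windows). [folklore] -/
private theorem sum_inv_one_add_sq_le (𝒯 : Finset ℝ)
    (hsep : ∀ t ∈ 𝒯, ∀ t' ∈ 𝒯, t ≠ t' → 1 ≤ |t - t'|) :
    ∑ t ∈ 𝒯, 1 / (1 + t ^ 2) ≤ 8 := by
  classical
  -- pointwise comparison with the window integral
  have hpt : ∀ t : ℝ, 1 / (1 + t ^ 2) ≤
      (5 / 2) * ∫ u in (t - 1 / 2)..(t + 1 / 2), 1 / (1 + u ^ 2) := by
    intro t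
    have hlow : ∀ u ∈ Set.Icc (t - 1 / 2) (t + 1 / 2), (2 / 5) * (1 / (1 + t ^ 2)) ≤ 1 / (1 + u ^ 2) := by
      intro u hu
      have hu1 : |u - t| ≤ 1 / 2 := abs_le.2 ⟨by linarith [hu.1], by linarith [hu.2]⟩
      have hu2 : u ^ 2 ≤ 2 * t ^ 2 + 1 / 2 := by
        have : (u - t) ^ 2 ≤ 1 / 4 := by
          have := abs_le.1 hu1; nlinarith
        nlinarith [sq_nonneg (u - 2 * t), sq_nonneg (u -t)]
      rw [mul_one_div, div_le_div_iff₀ (by positivity) (by positivity)]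
      nlinarith
    have hint : (∫ u in (t - 1 / 2)..(t + 1 / 2), (2 / 5) * (1 / (1 + t ^ 2))) ≤
        ∫ u in (t - 1 / 2)..(t + 1 / 2), 1 / (1 + u ^ 2) :=
      intervalIntegral.integral_mono_on (by linarith : t - 1 / 2 ≤ t + 1 / 2)
        intervalIntegrable_const (by
          apply Continuous.intervalIntegrable
          exact continuous_const.div (by fun_prop) fun u ↦ by positivity) hlow
    rw [intervalIntegral.integral_const, smul_eq_mul] at hint
    have h1 : (t + 1 / 2 - (t - 1 / 2)) = 1 := by ring
    rw [h1, one_mul] at hint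
    linarith
  -- the windows are disjoint: Gallagher's device
  rcases 𝒯.eq_empty_or_nonempty with h | hne
  · simp [h]
  obtain ⟨X, hX⟩ : ∃ X : ℝ, ∀ t ∈ 𝒯, |t| ≤ X :=
    ⟨𝒯.sup' hne fun t ↦ |t|, fun t ht ↦ Finset.le_sup' (fun t ↦ |t|) ht⟩
  have hG := Gallagher.sum_integral_le_integral_of_separated
    (h := fun u : ℝ ↦ 1 / (1 + u ^ 2)) (continuous_const.div (by fun_prop) fun u ↦ by positivity)
    (fun u ↦ by positivity) one_pos 𝒯 hsep (-(X + 1 / 2)) (X + 1 / 2)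
    (by linarith [(abs_nonneg _).trans (hX _ hne.choose_spec)])
    (fun t ht ↦ ⟨by linarith [(abs_le.1 (hX t ht)).1], by linarith [(abs_le.1 (hX t ht)).2]⟩)
  have htot : ∫ u in (-(X + 1 / 2))..(X + 1 / 2), 1 / (1 + u ^ 2) ≤ π := by
    have h1 : ∫ u in (-(X + 1 / 2))..(X + 1 / 2), 1 / (1 + u ^ 2) =
        Real.arctan (X + 1 / 2) - Real.arctan (-(X + 1 / 2)) := by
      rw [← integral_one_div_one_add_sq]
    rw [h1]
    have := Real.arctan_lt_pi_div_two (X + 1 / 2)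
    have := Real.neg_pi_div_two_lt_arctan (-(X + 1 / 2))
    linarith
  calc ∑ t ∈ 𝒯, 1 / (1 + t ^ 2)
      ≤ ∑ t ∈ 𝒯, (5 / 2) * ∫ u in (t - 1 / 2)..(t + 1 / 2), 1 / (1 + u ^ 2) :=
        Finset.sum_le_sum fun t _ ↦ hpt t
    _ = (5 / 2) * ∑ t ∈ 𝒯, ∫ u in (t - 1 / 2)..(t + 1 / 2), 1 / (1 + u ^ 2) := by
        rw [Finset.mul_sum]
    _ ≤ (5 / 2) * π := by gcongr; exact hG.trans htot
    _ ≤ 8 := by nlinarith [Real.pi_lt_d2]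

/-- A `1`-separated set of reals has at most two points in the open interval `(−1, 1)`. [folklore] -/
private theorem card_filter_abs_lt_one_le (𝒯 : Finset ℝ)
    (hsep : ∀ t ∈ 𝒯, ∀ t' ∈ 𝒯, t ≠ t' → 1 ≤ |t - t'|) :
    (𝒯.filter (fun t ↦ |t| < 1)).card ≤ 2 := by
  classical
  set A := 𝒯.filter (fun t ↦ |t| < 1) with hA
  -- nonnegative and negative parts each have at most one element
  have hpos : (A.filter (fun t ↦ 0 ≤ t)).card ≤ 1 := by
    rw [Finset.card_le_one]
    intro t ht t' ht'
    simp only [hA, Finset.mem_filter] at ht ht'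
    by_contra hne
    have h := hsep t ht.1.1 t' ht'.1.1 hne
    have h1 := abs_lt.1 ht.1.2; have h2 := abs_lt.1 ht'.1.2
    rw [le_abs] at h
    rcases h with h | h <;> linarith
  have hneg : (A.filter (fun t ↦ ¬ 0 ≤ t)).card ≤ 1 := by
    rw [Finset.card_le_one]
    intro t ht t' ht'
    simp only [hA, Finset.mem_filter] at ht ht'
    by_contra hne
    have h := hsep t ht.1.1 t' ht'.1.1 hne
    have h1 := abs_lt.1 ht.1.2; have h2 := abs_lt.1 ht'.1.2
    rw [le_abs] at h
    rcases h with h | h <;> linarith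
  have := Finset.card_filter_add_card_filter_not (s := A) (fun t : ℝ ↦ 0 ≤ t)
  omega

/-! ## §3. The Dirichlet series `∑ n^{-it} n^{-s} = ζ(s + it)` -/

/-- For real `t`, `|n^{-it}| ≤ 1` (natural `n`; value `0` or `1` at `n = 0`). [folklore] -/
private theorem norm_natCast_cpow_neg_mul_I_le (n : ℕ) (t : ℝ) :
    ‖(n : ℂ) ^ (-((t : ℂ) * I))‖ ≤ 1 := by
  rcases Nat.eq_zero_or_pos n with rfl | hn
  · simp only [Nat.cast_zero]
    by_cases h : (-((t : ℂ) * I)) = 0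
    · rw [h, Complex.cpow_zero]; simp
    · rw [Complex.zero_cpow h]; simp
  · rw [Complex.norm_natCast_cpow_of_pos hn]
    simp

/-- For real `t` and `n ≥ 1`, `|n^{-it}| = 1`. [folklore] -/
private theorem norm_natCast_cpow_neg_mul_I {n : ℕ} (hn : 0 < n) (t : ℝ) :
    ‖(n : ℂ) ^ (-((t : ℂ) * I))‖ = 1 := by
  rw [Complex.norm_natCast_cpow_of_pos hn]; simp

/-- `L(n ↦ n^{-it}, s) = ζ(s + it)` for `re s > 1`. [folklore] -/
private theorem LSeries_cpow_neg_mul_I {t : ℝ} {s : ℂ} (hs : 1 < s.re) :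
    LSeries (fun n : ℕ ↦ (n : ℂ) ^ (-((t : ℂ) * I))) s = riemannZeta (s + t * I) := by
  have hs' : 1 < (s + t * I).re := by simpa using hs
  rw [zeta_eq_tsum_one_div_nat_cpow hs', LSeries]
  refine tsum_congr fun n ↦ ?_
  rcases Nat.eq_zero_or_pos n with rfl | hn
  · rw [LSeries.term_zero]
    have : (s + t * I) ≠ 0 := fun h ↦ by
      have := congrArg Complex.re h; simp at this; linarith
    rw [Nat.cast_zero, Complex.zero_cpow this, div_zero]
  · rw [LSeries.term_of_ne_zero hn.ne', div_eq_div_iff (by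
        exact (Complex.cpow_ne_zero_iff_of_exponent_ne_zero (fun h ↦ by
          have := congrArg Complex.re h; simp at this; linarith)).2 (by exact_mod_cast hn.ne'))
      (by exact (Complex.cpow_ne_zero_iff_of_exponent_ne_zero (fun h ↦ by
          have := congrArg Complex.re h; simp at this; linarith)).2 (by exact_mod_cast hn.ne')),
      one_mul, ← Complex.cpow_add _ _ (by exact_mod_cast hn.ne')]
    congr 1; ring

/-! ## §4. Bounds for `ζ` used on the contour -/

/-- On `σ ≥ 1/2`, `|θ| ≥ 3`: `‖ζ(σ + iθ)‖ ≤ 31 |θ|^{1/2} (1 + log|θ|)` (Titchmarsh (3.5.3) on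
`[1/2, 1]`, tree `HuxleyLV.norm_zeta_le_rpow_log`, and Theorem 3.5 on `σ ≥ 1`, tree
`ZetaOneLine.norm_riemannZeta_le_log`). [folklore] -/
private theorem norm_zeta_le_on_strip {s : ℂ} (hσ0 : 1 / 2 ≤ s.re) (ht : 3 ≤ |s.im|) :
    ‖riemannZeta s‖ ≤ 31 * |s.im| ^ (1 / 2 : ℝ) * (1 + Real.log |s.im|) := by
  have ht1 : 1 ≤ |s.im| := by linarith
  have hlog0 : 0 ≤ Real.log |s.im| := Real.log_nonneg ht1
  have hsq1 : 1 ≤ |s.im| ^ (1 / 2 : ℝ) := Real.one_le_rpow ht1 (by norm_num)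
  rcases le_or_gt s.re 1 with h1 | h1
  · have h := HuxleyLV.norm_zeta_le_rpow_log hσ0 h1 ht
    have hpow : |s.im| ^ (1 - s.re) ≤ |s.im| ^ (1 / 2 : ℝ) :=
      Real.rpow_le_rpow_of_exponent_le ht1 (by linarith)
    calc ‖riemannZeta s‖ ≤ 10 * |s.im| ^ (1 - s.re) * (1 + Real.log |s.im|) := h
      _ ≤ 10 * |s.im| ^ (1 / 2 : ℝ) * (1 + Real.log |s.im|) := by gcongr
      _ ≤ 31 * |s.im| ^ (1 / 2 : ℝ) * (1 + Real.log |s.im|) := by gcongr; norm_num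
  · have hlog1 : 1 < Real.log |s.im| :=
      MertensBound.one_lt_log_three.trans_le (Real.log_le_log (by norm_num) ht)
    have hreg : 1 - 1 / (2 * Real.log |s.im|) ≤ s.re := by
      have : 0 < 1 / (2 * Real.log |s.im|) := by positivity
      linarith
    have h := ZetaOneLine.norm_riemannZeta_le_log ht hreg
    calc ‖riemannZeta s‖ ≤ 21 * Real.log |s.im| := h
      _ ≤ 21 * |s.im| ^ (1 / 2 : ℝ) * (1 + Real.log |s.im|) := by
          rw [mul_assoc]; gcongr
          nlinarith
      _ ≤ 31 * |s.im| ^ (1 / 2 : ℝ) * (1 + Real.log |s.im|) := by gcongr; norm_num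

/-- On the critical line near the real axis: `‖ζ(1/2 + iu)‖ ≤ 16` for `|u| ≤ 3`. [folklore] -/
private theorem norm_zeta_half_le_sixteen {u : ℝ} (hu : |u| ≤ 3) :
    ‖riemannZeta (1 / 2 + u * I)‖ ≤ 16 :=
  HuxleyLV.norm_zeta_le_sixteen (by simp) (by simp; norm_num) (by simpa using hu)

/-! ## §5. The discrete fourth moment at shifted points -/

/-- **Discrete fourth moment at shifted well-spaced points.** If `C₄` is a constant for the
named fact `Huxley1972_fourthMoment_discrete`, `𝒯 ⊂ [−T, T]` is `1`-separated and `|y| ≤ Y` with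
`T + Y ≥ 2`, then `∑_{t∈𝒯} |ζ(1/2 + i(t+y))|⁴ ≤ C₄ (T+Y) log⁵(T+Y) + 2·16⁴` (the at most two
shifted points with `|t + y| < 1` are bounded by `norm_zeta_half_le_sixteen`).
[cite: Ivic1985, (8.26)] [cite: Huxley1972, Ch. 22, (22.22)] -/
theorem sum_norm_zeta_pow_four_shift_le {C₄ : ℝ}
    (hC₄ : ∀ (T : ℝ) (𝒯 : Finset ℝ), 2 ≤ T →
      (∀ t ∈ 𝒯, 1 ≤ |t| ∧ |t| ≤ T) → (∀ t ∈ 𝒯, ∀ t' ∈ 𝒯, t ≠ t' → 1 ≤ |t - t'|) →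
      ∑ t ∈ 𝒯, ‖riemannZeta (1 / 2 + t * I)‖ ^ 4 ≤ C₄ * T * Real.log T ^ 5)
    {T Y y : ℝ} (hTY : 2 ≤ T + Y) (hy : |y| ≤ Y) (𝒯 : Finset ℝ) (h𝒯 : ∀ t ∈ 𝒯, |t| ≤ T)
    (hsep : ∀ t ∈ 𝒯, ∀ t' ∈ 𝒯, t ≠ t' → 1 ≤ |t - t'|) :
    ∑ t ∈ 𝒯, ‖riemannZeta (1 / 2 + ((t + y : ℝ) : ℂ) * I)‖ ^ 4 ≤
      C₄ * (T + Y) * Real.log (T + Y) ^ 5 + 2 * 16 ^ 4 := by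
  classical
  set U : Finset ℝ := 𝒯.image (fun t ↦ t + y) with hU
  have hinj : Set.InjOn (fun t : ℝ ↦ t + y) 𝒯 := fun t _ t' _ h ↦ by simpa using h
  have hsum : ∑ t ∈ 𝒯, ‖riemannZeta (1 / 2 + ((t + y : ℝ) : ℂ) * I)‖ ^ 4 =
      ∑ u ∈ U, ‖riemannZeta (1 / 2 + (u : ℂ) * I)‖ ^ 4 := by
    rw [hU, Finset.sum_image hinj]
  have hUsep : ∀ u ∈ U, ∀ u' ∈ U, u ≠ u' → 1 ≤ |u - u'| := by
    intro u hu u' hu' hne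
    simp only [hU, Finset.mem_image] at hu hu'
    obtain ⟨t, ht, rfl⟩ := hu
    obtain ⟨t', ht', rfl⟩ := hu'
    have : t ≠ t' := fun h ↦ hne (by rw [h])
    simpa using hsep t ht t' ht' this
  have hUabs : ∀ u ∈ U, |u| ≤ T + Y := by
    intro u hu
    simp only [hU, Finset.mem_image] at hu
    obtain ⟨t, ht, rfl⟩ := hu
    exact (abs_add_le _ _).trans (add_le_add (h𝒯 t ht) hy)
  rw [hsum, ← Finset.sum_filter_add_sum_filter_not U (fun u ↦ 1 ≤ |u|)]
  refine add_le_add ?_ ?_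
  · refine hC₄ (T + Y) _ hTY (fun u hu ↦ ?_) (fun u hu u' hu' hne ↦ ?_)
    · rw [Finset.mem_filter] at hu; exact ⟨hu.2, hUabs u hu.1⟩
    · rw [Finset.mem_filter] at hu hu'; exact hUsep u hu.1 u' hu'.1 hne
  · have hcard : (U.filter (fun u ↦ ¬ 1 ≤ |u|)).card ≤ 2 := by
      have h := card_filter_abs_lt_one_le U hUsep
      have heq : U.filter (fun u ↦ ¬ 1 ≤ |u|) = U.filter (fun u ↦ |u| < 1) := by
        ext u; simp [not_le]
      rw [heq]; exact h
    have hle : ∀ u ∈ U.filter (fun u ↦ ¬ 1 ≤ |u|), ‖riemannZeta (1 / 2 + (u : ℂ) * I)‖ ^ 4 ≤ 16 ^ 4 := by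
      intro u hu
      rw [Finset.mem_filter, not_le] at hu
      exact pow_le_pow_left₀ (norm_nonneg _) (norm_zeta_half_le_sixteen (by linarith [hu.2])) 4
    calc ∑ u ∈ U.filter (fun u ↦ ¬ 1 ≤ |u|), ‖riemannZeta (1 / 2 + (u : ℂ) * I)‖ ^ 4
        ≤ ∑ _u ∈ U.filter (fun u ↦ ¬ 1 ≤ |u|), (16 : ℝ) ^ 4 := Finset.sum_le_sum hle
      _ = (U.filter (fun u ↦ ¬ 1 ≤ |u|)).card * 16 ^ 4 := by rw [Finset.sum_const, nsmul_eq_mul]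
      _ ≤ 2 * 16 ^ 4 := by gcongr; exact_mod_cast hcard

/-- **The mean square over shifted well-spaced points from the fourth moment** (Cauchy–Schwarz):
under the hypotheses of `sum_norm_zeta_pow_four_shift_le`,
`∑_{t∈𝒯} |ζ(1/2 + i(t+y))|² ≤ (#𝒯)^{1/2} (C₄ (T+Y) log⁵(T+Y) + 2·16⁴)^{1/2}`.
[cite: Jutila1977, proof of Lemma 3, p. 59] -/
theorem sum_norm_zeta_sq_shift_le {C₄ : ℝ}
    (hC₄ : ∀ (T : ℝ) (𝒯 : Finset ℝ), 2 ≤ T →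
      (∀ t ∈ 𝒯, 1 ≤ |t| ∧ |t| ≤ T) → (∀ t ∈ 𝒯, ∀ t' ∈ 𝒯, t ≠ t' → 1 ≤ |t - t'|) →
      ∑ t ∈ 𝒯, ‖riemannZeta (1 / 2 + t * I)‖ ^ 4 ≤ C₄ * T * Real.log T ^ 5)
    {T Y y : ℝ} (hTY : 2 ≤ T + Y) (hy : |y| ≤ Y) (𝒯 : Finset ℝ) (h𝒯 : ∀ t ∈ 𝒯, |t| ≤ T)
    (hsep : ∀ t ∈ 𝒯, ∀ t' ∈ 𝒯, t ≠ t' → 1 ≤ |t - t'|) :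
    ∑ t ∈ 𝒯, ‖riemannZeta (1 / 2 + ((t + y : ℝ) : ℂ) * I)‖ ^ 2 ≤
      Real.sqrt (𝒯.card * (C₄ * (T + Y) * Real.log (T + Y) ^ 5 + 2 * 16 ^ 4)) := by
  have h4 := sum_norm_zeta_pow_four_shift_le hC₄ hTY hy 𝒯 h𝒯 hsep
  have hcs := sum_mul_sq_le_sq_mul_sq 𝒯 (fun _ ↦ (1 : ℝ))
    (fun t ↦ ‖riemannZeta (1 / 2 + ((t + y : ℝ) : ℂ) * I)‖ ^ 2)
  simp only [one_pow, Finset.sum_const, nsmul_eq_mul, mul_one, one_mul] at hcs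
  have hcs' : (∑ t ∈ 𝒯, ‖riemannZeta (1 / 2 + ((t + y : ℝ) : ℂ) * I)‖ ^ 2) ^ 2 ≤
      𝒯.card * (C₄ * (T + Y) * Real.log (T + Y) ^ 5 + 2 * 16 ^ 4) := by
    refine hcs.trans (mul_le_mul_of_nonneg_left ?_ (Nat.cast_nonneg _))
    refine le_trans (le_of_eq ?_) h4
    refine Finset.sum_congr rfl fun t _ ↦ ?_; ring
  have h0 : 0 ≤ ∑ t ∈ 𝒯, ‖riemannZeta (1 / 2 + ((t + y : ℝ) : ℂ) * I)‖ ^ 2 :=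
    Finset.sum_nonneg fun t _ ↦ by positivity
  rw [Real.le_sqrt h0 (le_trans (sq_nonneg _) hcs')]
  exact hcs'

/-! ## §6. The Perron integral for `∑_{n ≤ L} n^{-it}` and the contour shift to `Re w = 1/2` -/

/-- **Truncated Perron formula for the zeta sum**: with `x = L + 1/2`, `c = 1 + 1/log x`,
`∑_{n ≤ L} n^{-it} = (1/2πi)∫_{c−iT₃}^{c+iT₃} ζ(w + it) x^w dw/w + O(x log x/T₃)` (tree:
`PerronBounded.exists_norm_perron_bounded_sub_le` with `a_n = n^{-it}`, `L(a, w) = ζ(w + it)`).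
[cite: MontgomeryVaughan2007, Cor. 5.3] -/
theorem perron_zetaSum : ∃ K : ℝ, 0 < K ∧ ∀ (L : ℕ), 3 ≤ L → ∀ (x c : ℝ), x = L + 1 / 2 →
    c = 1 + 1 / Real.log x → ∀ (t T₃ : ℝ), 0 < T₃ →
    ‖(∫ y in (-T₃)..T₃, riemannZeta ((c : ℂ) + y * I + t * I) *
        ((x : ℂ) ^ ((c : ℂ) + y * I) / ((c : ℂ) + y * I))) -
      2 * π * ∑ n ∈ Finset.Icc 1 L, (n : ℂ) ^ (-((t : ℂ) * I))‖ ≤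
      K * x * Real.log x * (1 / T₃ + 1 / T₃) := by
  obtain ⟨K, hK0, hK⟩ := PerronBounded.exists_norm_perron_bounded_sub_le
  refine ⟨K, hK0, fun L hL x c hx hc t T₃ hT₃ ↦ ?_⟩
  have h := hK (fun n : ℕ ↦ (n : ℂ) ^ (-((t : ℂ) * I))) (fun n ↦ norm_natCast_cpow_neg_mul_I_le n t)
    L hL x c hx hc T₃ T₃ hT₃ hT₃
  obtain ⟨hx0, hlog, hc1, -, -, -⟩ := halfInt_facts hL hx hc
  have hcongr : (∫ y in (-T₃)..T₃, LSeries (fun n : ℕ ↦ (n : ℂ) ^ (-((t : ℂ) * I))) (c + y * I) *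
      ((x : ℂ) ^ ((c : ℂ) + y * I) / ((c : ℂ) + y * I))) =
      ∫ y in (-T₃)..T₃, riemannZeta ((c : ℂ) + y * I + t * I) *
        ((x : ℂ) ^ ((c : ℂ) + y * I) / ((c : ℂ) + y * I)) := by
    refine intervalIntegral.integral_congr fun y _ ↦ ?_
    rw [LSeries_cpow_neg_mul_I (by simp; linarith)]
  rw [hcongr] at h
  exact h

/-- **The rectangle `[1/2, b] × [−T₃, T₃]` for `w ↦ ζ(w + it) x^w/w`** (Cauchy's formula on a
rectangle, tree `Literature.Analysis.Complex.integral_boundary_rect_div_sub_eq`, applied to the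
entire `w ↦ ζ₁(w + it) x^w/w` with `ζ = ζ₁/(w + it − 1)`; the only pole inside is `w = 1 − it`,
with residue `x^{1−it}/(1 − it)`):
`∫_{b} = 2π x^{1−it}/(1−it) + ∫_{1/2} + i (∫_{bottom} − ∫_{top})`. [cite: Jutila1977, proof of Lemma 3, p. 59] -/
theorem perron_rect_identity {x : ℝ} (hx : 0 < x) (t : ℝ) {b T₃ : ℝ} (hb : 1 < b) (hT₃ : |t| < T₃) :
    (∫ y in (-T₃)..T₃, riemannZeta ((b : ℂ) + y * I + t * I) *
        ((x : ℂ) ^ ((b : ℂ) + y * I) / ((b : ℂ) + y * I))) =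
      2 * π * ((x : ℂ) ^ (1 - (t : ℂ) * I) / (1 - (t : ℂ) * I)) +
      (∫ y in (-T₃)..T₃, riemannZeta (((1 / 2 : ℝ) : ℂ) + y * I + t * I) *
        ((x : ℂ) ^ (((1 / 2 : ℝ) : ℂ) + y * I) / (((1 / 2 : ℝ) : ℂ) + y * I))) +
      I * ((∫ σ in (1 / 2 : ℝ)..b, riemannZeta ((σ : ℂ) + ((-T₃ : ℝ) : ℂ) * I + t * I) *
          ((x : ℂ) ^ ((σ : ℂ) + ((-T₃ : ℝ) : ℂ) * I) / ((σ : ℂ) + ((-T₃ : ℝ) : ℂ) * I))) -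
        (∫ σ in (1 / 2 : ℝ)..b, riemannZeta ((σ : ℂ) + (T₃ : ℂ) * I + t * I) *
          ((x : ℂ) ^ ((σ : ℂ) + (T₃ : ℂ) * I) / ((σ : ℂ) + (T₃ : ℂ) * I)))) := by
  set ρ : ℂ := 1 - (t : ℂ) * I with hρ
  set f : ℂ → ℂ := fun w ↦ riemannZeta₁ (w + t * I) * (x : ℂ) ^ w / w with hf
  set g : ℂ → ℂ := fun w ↦ riemannZeta (w + t * I) * ((x : ℂ) ^ w / w) with hg
  have hρre : ρ.re = 1 := by simp [hρ]
  have hρim : ρ.im = -t := by simp [hρ]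
  -- `g = f/(w − ρ)` off `ρ`
  have hgf : ∀ w : ℂ, w ≠ ρ → g w = f w / (w - ρ) := by
    intro w hw
    have hs : w + t * I ≠ 1 := by
      intro h; apply hw; rw [hρ]; linear_combination h
    simp only [hg, hf]
    rw [riemannZeta_eq_inv_sub_mul hs]
    have hwρ : w - ρ ≠ 0 := sub_ne_zero.2 hw
    have : w + t * I - 1 = w - ρ := by rw [hρ]; ring
    rw [this]
    field_simp
  -- `f` is differentiable on the closed rectangle (it avoids `w = 0`)
  have hfd : DifferentiableOn ℂ f (Icc (1 / 2) b ×ℂ Icc (-T₃) T₃) := by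
    intro w hw
    have hw0 : w ≠ 0 := by
      intro h0
      have h1 : (1 : ℝ) / 2 ≤ w.re := (Complex.mem_reProdIm.1 hw).1.1
      rw [h0] at h1; norm_num at h1
    refine DifferentiableAt.differentiableWithinAt ?_
    simp only [hf]
    refine DifferentiableAt.div (DifferentiableAt.mul ?_ ?_) differentiableAt_id hw0
    · exact (differentiable_riemannZeta₁.differentiableAt).comp w
        (differentiableAt_id.add_const _)
    · exact (differentiable_const_cpow hx).differentiableAt
  have hCauchy := Literature.Analysis.Complex.integral_boundary_rect_div_sub_eq (f := f) ρ
    (a := 1 / 2) (b := b) (c := -T₃) (d := T₃)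
    (by rw [hρre]; norm_num) (by rw [hρre]; exact hb)
    (by rw [hρim]; linarith [neg_abs_le t, le_abs_self t])
    (by rw [hρim]; linarith [le_abs_self t, neg_abs_le t]) hfd
  -- value at the pole
  have hfρ : f ρ = (x : ℂ) ^ (1 - (t : ℂ) * I) / (1 - (t : ℂ) * I) := by
    simp only [hf, hρ]
    have : (1 - (t : ℂ) * I + t * I) = 1 := by ring
    rw [this, riemannZeta₁_one, one_mul]
  -- the four sides avoid `ρ`
  have hne_h : ∀ (σ y : ℝ), y ≠ -t → (σ : ℂ) + y * I ≠ ρ := by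
    intro σ y hy h; apply hy; have := congrArg Complex.im h; simpa [hρ] using this
  have hne_v : ∀ (σ y : ℝ), σ ≠ 1 → (σ : ℂ) + y * I ≠ ρ := by
    intro σ y hσ h; apply hσ; have := congrArg Complex.re h; simpa [hρ] using this
  have hT₃t : (-T₃ : ℝ) ≠ -t := by
    intro h; have : T₃ = t := by linarith
    linarith [le_abs_self t]
  have hT₃t' : (T₃ : ℝ) ≠ -t := by intro h; linarith [neg_abs_le t]
  -- rewrite the four integrands as `g`
  have hbot : (∫ σ in (1 / 2 : ℝ)..b, f ((σ : ℂ) + ((-T₃ : ℝ) : ℂ) * I) / ((σ : ℂ) + ((-T₃ : ℝ) : ℂ) * I - ρ)) =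
      ∫ σ in (1 / 2 : ℝ)..b, g ((σ : ℂ) + ((-T₃ : ℝ) : ℂ) * I) :=
    intervalIntegral.integral_congr fun σ _ ↦ (hgf _ (hne_h σ (-T₃) hT₃t)).symm
  have htop : (∫ σ in (1 / 2 : ℝ)..b, f ((σ : ℂ) + (T₃ : ℂ) * I) / ((σ : ℂ) + (T₃ : ℂ) * I - ρ)) =
      ∫ σ in (1 / 2 : ℝ)..b, g ((σ : ℂ) + (T₃ : ℂ) * I) :=
    intervalIntegral.integral_congr fun σ _ ↦ (hgf _ (hne_h σ T₃ hT₃t')).symm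
  have hright : (∫ y in (-T₃)..T₃, f ((b : ℂ) + y * I) / ((b : ℂ) + y * I - ρ)) =
      ∫ y in (-T₃)..T₃, g ((b : ℂ) + y * I) :=
    intervalIntegral.integral_congr fun y _ ↦ (hgf _ (hne_v b y hb.ne')).symm
  have hleft : (∫ y in (-T₃)..T₃, f ((((1 / 2 : ℝ)) : ℂ) + y * I) / ((((1 / 2 : ℝ)) : ℂ) + y * I - ρ)) =
      ∫ y in (-T₃)..T₃, g ((((1 / 2 : ℝ)) : ℂ) + y * I) :=
    intervalIntegral.integral_congr fun y _ ↦ (hgf _ (hne_v (1 / 2) y (by norm_num))).symm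
  rw [hbot, htop, hright, hleft, hfρ] at hCauchy
  -- unfold `g` in the goal and solve the linear relation
  have eb : (∫ y in (-T₃)..T₃, riemannZeta ((b : ℂ) + y * I + t * I) *
      ((x : ℂ) ^ ((b : ℂ) + y * I) / ((b : ℂ) + y * I))) = ∫ y in (-T₃)..T₃, g ((b : ℂ) + y * I) := rfl
  have eh : (∫ y in (-T₃)..T₃, riemannZeta (((1 / 2 : ℝ) : ℂ) + y * I + t * I) *
      ((x : ℂ) ^ (((1 / 2 : ℝ) : ℂ) + y * I) / (((1 / 2 : ℝ) : ℂ) + y * I))) =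
      ∫ y in (-T₃)..T₃, g (((1 / 2 : ℝ) : ℂ) + y * I) := rfl
  have e1 : (∫ σ in (1 / 2 : ℝ)..b, riemannZeta ((σ : ℂ) + ((-T₃ : ℝ) : ℂ) * I + t * I) *
      ((x : ℂ) ^ ((σ : ℂ) + ((-T₃ : ℝ) : ℂ) * I) / ((σ : ℂ) + ((-T₃ : ℝ) : ℂ) * I))) =
      ∫ σ in (1 / 2 : ℝ)..b, g ((σ : ℂ) + ((-T₃ : ℝ) : ℂ) * I) := rfl
  have e2 : (∫ σ in (1 / 2 : ℝ)..b, riemannZeta ((σ : ℂ) + (T₃ : ℂ) * I + t * I) *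
      ((x : ℂ) ^ ((σ : ℂ) + (T₃ : ℂ) * I) / ((σ : ℂ) + (T₃ : ℂ) * I))) =
      ∫ σ in (1 / 2 : ℝ)..b, g ((σ : ℂ) + (T₃ : ℂ) * I) := rfl
  rw [eb, eh, e1, e2]
  linear_combination (-I) * hCauchy +
    ((∫ y in (-T₃)..T₃, g ((b : ℂ) + y * I)) - (∫ y in (-T₃)..T₃, g (((1 / 2 : ℝ) : ℂ) + y * I)) -
      2 * π * ((x : ℂ) ^ (1 - (t : ℂ) * I) / (1 - (t : ℂ) * I))) * Complex.I_mul_I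


/-- The left side `Re w = 1/2`:
`‖∫_{-T₃}^{T₃} ζ(1/2+iy+it) x^{1/2+iy}/(1/2+iy) dy‖ ≤ x^{1/2} ∫_{-T₃}^{T₃} |ζ(1/2+i(y+t))|/|1/2+iy| dy`.
[folklore] -/
private theorem norm_left_side_le {x : ℝ} (hx : 0 < x) (t : ℝ) {T₃ : ℝ} (hT₃ : 0 ≤ T₃) :
    ‖∫ y in (-T₃)..T₃, riemannZeta (((1 / 2 : ℝ) : ℂ) + y * I + t * I) *
        ((x : ℂ) ^ (((1 / 2 : ℝ) : ℂ) + y * I) / (((1 / 2 : ℝ) : ℂ) + y * I))‖ ≤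
      x ^ (1 / 2 : ℝ) * ∫ y in (-T₃)..T₃,
        ‖riemannZeta (((1 / 2 : ℝ) : ℂ) + y * I + t * I)‖ / ‖((1 / 2 : ℝ) : ℂ) + y * I‖ := by
  have hle : -T₃ ≤ T₃ := by linarith
  refine (intervalIntegral.norm_integral_le_integral_norm hle).trans (le_of_eq ?_)
  rw [← intervalIntegral.integral_const_mul]
  refine intervalIntegral.integral_congr fun y _ ↦ ?_
  simp only [norm_mul, norm_div, norm_cpow_line hx]
  ring

/-- A horizontal side `Im w = s`, `|s| = T₃ ≥ |t| + 3`, `T₃ + |t| ≤ Θ`, `1/2 ≤ σ ≤ b ≤ 2`, `x ≥ 1`: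
`‖∫_{1/2}^{b} ζ(σ+is+it) x^{σ+is}/(σ+is) dσ‖ ≤ (b − 1/2) · 31 Θ^{1/2}(1+log Θ) x^b/T₃`. [folklore] -/
private theorem norm_horizontal_side_le {x : ℝ} (hx : 1 ≤ x) (t : ℝ) {b T₃ Θ s : ℝ} (hb : 1 / 2 ≤ b)
    (hT₃ : |t| + 3 ≤ T₃) (hΘ : T₃ + |t| ≤ Θ) (hs : |s| = T₃) :
    ‖∫ σ in (1 / 2 : ℝ)..b, riemannZeta ((σ : ℂ) + (s : ℂ) * I + t * I) *
        ((x : ℂ) ^ ((σ : ℂ) + (s : ℂ) * I) / ((σ : ℂ) + (s : ℂ) * I))‖ ≤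
      (31 * Θ ^ (1 / 2 : ℝ) * (1 + Real.log Θ) * x ^ b / T₃) * |b - 1 / 2| := by
  have hx0 : 0 < x := by linarith
  have hT₃0 : 0 < T₃ := by linarith [abs_nonneg t]
  have hst3 : 3 ≤ |s + t| := by
    have := abs_add_le (s + t) (-t)
    simp only [add_neg_cancel_right, abs_neg] at this
    linarith
  have hstΘ : |s + t| ≤ Θ := (abs_add_le s t).trans (by linarith)
  have hΘ3 : 3 ≤ Θ := hst3.trans hstΘ
  refine intervalIntegral.norm_integral_le_of_norm_le_const fun σ hσ ↦ ?_
  rw [Set.uIoc_of_le hb] at hσ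
  obtain ⟨hσ1, hσ2⟩ := hσ
  -- the zeta factor
  have hζ : ‖riemannZeta ((σ : ℂ) + (s : ℂ) * I + t * I)‖ ≤ 31 * Θ ^ (1 / 2 : ℝ) * (1 + Real.log Θ) := by
    have him : ((σ : ℂ) + (s : ℂ) * I + t * I).im = s + t := by simp
    have hre : ((σ : ℂ) + (s : ℂ) * I + t * I).re = σ := by simp
    have h := norm_zeta_le_on_strip (s := (σ : ℂ) + (s : ℂ) * I + t * I) (by rw [hre]; linarith)
      (by rw [him]; exact hst3)
    rw [him] at h
    refine h.trans ?_
    have h1 : |s + t| ^ (1 / 2 : ℝ) ≤ Θ ^ (1 / 2 : ℝ) :=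
      Real.rpow_le_rpow (abs_nonneg _) hstΘ (by norm_num)
    have h2 : Real.log |s + t| ≤ Real.log Θ := Real.log_le_log (by linarith) hstΘ
    have h3 : 0 ≤ 1 + Real.log |s + t| := by
      have := Real.log_nonneg (show (1 : ℝ) ≤ |s + t| by linarith); linarith
    gcongr
  -- the kernel factor
  have hker : ‖(x : ℂ) ^ ((σ : ℂ) + (s : ℂ) * I) / ((σ : ℂ) + (s : ℂ) * I)‖ ≤ x ^ b / T₃ := by
    rw [norm_div, norm_cpow_line hx0]
    have hden : T₃ ≤ ‖(σ : ℂ) + (s : ℂ) * I‖ := by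
      have := Complex.abs_im_le_norm ((σ : ℂ) + (s : ℂ) * I)
      simp only [add_im, ofReal_im, mul_im, ofReal_re, I_im, mul_one, I_re, mul_zero, add_zero,
        zero_add] at this
      rw [hs] at this; exact this
    have hnum : x ^ σ ≤ x ^ b := Real.rpow_le_rpow_of_exponent_le hx hσ2
    exact div_le_div₀ (by positivity) hnum hT₃0 hden
  rw [norm_mul]
  have h0 : 0 ≤ 31 * Θ ^ (1 / 2 : ℝ) * (1 + Real.log Θ) := by
    have := Real.log_nonneg (show (1 : ℝ) ≤ Θ by linarith); positivity
  calc ‖riemannZeta ((σ : ℂ) + (s : ℂ) * I + t * I)‖ *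
        ‖(x : ℂ) ^ ((σ : ℂ) + (s : ℂ) * I) / ((σ : ℂ) + (s : ℂ) * I)‖
      ≤ (31 * Θ ^ (1 / 2 : ℝ) * (1 + Real.log Θ)) * (x ^ b / T₃) :=
        mul_le_mul hζ hker (norm_nonneg _) h0
    _ = 31 * Θ ^ (1 / 2 : ℝ) * (1 + Real.log Θ) * x ^ b / T₃ := by ring

/-- **Pointwise bound for the zeta sum `∑_{n ≤ L} n^{-it}` from the shifted Perron integral**
(`L ≥ 3`, `x = L + 1/2`, `T₃ ≥ |t| + 3`, `T₃ + |t| ≤ Θ`): `2π |∑_{n≤L} n^{-it}| ≤ 2πx/√(1+t²) +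
x^{1/2}∫_{-T₃}^{T₃}|ζ(1/2+i(y+t))|/|1/2+iy| dy + 2·(3/2)·31Θ^{1/2}(1+log Θ)·e·x/T₃ + 2K x log x/T₃`.
[cite: Jutila1977, proof of Lemma 3, p. 59] -/
theorem norm_zetaSum_le_pointwise : ∃ K : ℝ, 0 < K ∧ ∀ (L : ℕ), 3 ≤ L →
    ∀ (t T₃ Θ : ℝ), |t| + 3 ≤ T₃ → T₃ + |t| ≤ Θ →
    2 * π * ‖∑ n ∈ Finset.Icc 1 L, (n : ℂ) ^ (-((t : ℂ) * I))‖ ≤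
      2 * π * (((L : ℝ) + 1 / 2) / Real.sqrt (1 + t ^ 2)) +
      ((L : ℝ) + 1 / 2) ^ (1 / 2 : ℝ) *
        (∫ y in (-T₃)..T₃, ‖riemannZeta (((1 / 2 : ℝ) : ℂ) + y * I + t * I)‖ /
          ‖((1 / 2 : ℝ) : ℂ) + y * I‖) +
      2 * ((31 * Θ ^ (1 / 2 : ℝ) * (1 + Real.log Θ) * (Real.exp 1 * ((L : ℝ) + 1 / 2)) / T₃) *
        (3 / 2)) +
      2 * K * ((L : ℝ) + 1 / 2) * Real.log ((L : ℝ) + 1 / 2) / T₃ := by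
  obtain ⟨K, hK0, hK⟩ := perron_zetaSum
  refine ⟨K, hK0, fun L hL t T₃ Θ hT₃ hΘ ↦ ?_⟩
  set x : ℝ := (L : ℝ) + 1 / 2 with hx
  set c : ℝ := 1 + 1 / Real.log x with hc
  obtain ⟨hx0, hlog, hc1, hc2, hxc, -⟩ := halfInt_facts hL hx hc
  have hL3 : (3 : ℝ) ≤ L := by exact_mod_cast hL
  have hx1 : 1 ≤ x := by rw [hx]; linarith
  have hT₃0 : 0 < T₃ := by linarith [abs_nonneg t]
  have htT : |t| < T₃ := by linarith
  -- Perron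
  have hP := hK L hL x c rfl rfl t T₃ hT₃0
  -- rectangle
  have hR := perron_rect_identity hx0 t hc1 htT
  set G : ℂ := ∑ n ∈ Finset.Icc 1 L, (n : ℂ) ^ (-((t : ℂ) * I)) with hG
  set Vc : ℂ := ∫ y in (-T₃)..T₃, riemannZeta ((c : ℂ) + y * I + t * I) *
    ((x : ℂ) ^ ((c : ℂ) + y * I) / ((c : ℂ) + y * I)) with hVc
  set Vh : ℂ := ∫ y in (-T₃)..T₃, riemannZeta (((1 / 2 : ℝ) : ℂ) + y * I + t * I) *
    ((x : ℂ) ^ (((1 / 2 : ℝ) : ℂ) + y * I) / (((1 / 2 : ℝ) : ℂ) + y * I)) with hVh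
  set Bot : ℂ := ∫ σ in (1 / 2 : ℝ)..c, riemannZeta ((σ : ℂ) + ((-T₃ : ℝ) : ℂ) * I + t * I) *
    ((x : ℂ) ^ ((σ : ℂ) + ((-T₃ : ℝ) : ℂ) * I) / ((σ : ℂ) + ((-T₃ : ℝ) : ℂ) * I)) with hBot
  set Top : ℂ := ∫ σ in (1 / 2 : ℝ)..c, riemannZeta ((σ : ℂ) + (T₃ : ℂ) * I + t * I) *
    ((x : ℂ) ^ ((σ : ℂ) + (T₃ : ℂ) * I) / ((σ : ℂ) + (T₃ : ℂ) * I)) with hTop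
  set Res : ℂ := (x : ℂ) ^ (1 - (t : ℂ) * I) / (1 - (t : ℂ) * I) with hRes
  -- norms of the pieces
  have hRes_norm : ‖Res‖ = x / Real.sqrt (1 + t ^ 2) := by
    rw [hRes, norm_div, Complex.norm_cpow_eq_rpow_re_of_pos hx0]
    have h1 : (1 - (t : ℂ) * I) = ((1 : ℝ) : ℂ) + ((-t : ℝ) : ℂ) * I := by push_cast; ring
    rw [h1, Complex.norm_add_mul_I]
    simp
  have hVh_norm := norm_left_side_le hx0 t hT₃0.le
  have hcb : (1 : ℝ) / 2 ≤ c := by linarith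
  have hTop_norm := norm_horizontal_side_le hx1 t hcb hT₃ hΘ (abs_of_pos hT₃0)
  have hBot_norm := norm_horizontal_side_le hx1 t hcb hT₃ hΘ (s := -T₃)
    (by rw [abs_neg, abs_of_pos hT₃0])
  have hcabs : |c - 1 / 2| ≤ 3 / 2 := by rw [abs_of_nonneg (by linarith)]; linarith
  have hxb : x ^ c = Real.exp 1 * x := hxc
  have hΘ3 : 3 ≤ Θ := by linarith [abs_nonneg t]
  have hH0 : 0 ≤ 31 * Θ ^ (1 / 2 : ℝ) * (1 + Real.log Θ) * x ^ c / T₃ := by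
    have := Real.log_nonneg (show (1 : ℝ) ≤ Θ by linarith); positivity
  -- assemble
  have hmain : 2 * π * ‖G‖ ≤ ‖Vc‖ + K * x * Real.log x * (1 / T₃ + 1 / T₃) := by
    have h1 : ‖(2 * π : ℂ) * G‖ ≤ ‖Vc‖ + ‖Vc - 2 * π * G‖ := by
      have := norm_sub_le Vc (Vc - 2 * π * G)
      rwa [sub_sub_cancel] at this
    have h2 : ‖(2 * π : ℂ) * G‖ = 2 * π * ‖G‖ := by
      rw [norm_mul]; congr 1
      rw [show (2 * π : ℂ) = ((2 * π : ℝ) : ℂ) by push_cast; ring, Complex.norm_real,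
        Real.norm_of_nonneg (by positivity)]
    rw [← h2]
    exact h1.trans (add_le_add le_rfl hP)
  have hVc_le : ‖Vc‖ ≤ 2 * π * ‖Res‖ + ‖Vh‖ + (‖Bot‖ + ‖Top‖) := by
    rw [hR]
    refine (norm_add_le _ _).trans (add_le_add ((norm_add_le _ _).trans (add_le_add ?_ le_rfl)) ?_)
    · rw [norm_mul]
      rw [show (2 * π : ℂ) = ((2 * π : ℝ) : ℂ) by push_cast; ring, Complex.norm_real,
        Real.norm_of_nonneg (by positivity)]
    · rw [norm_mul, Complex.norm_I, one_mul]
      exact norm_sub_le _ _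
  calc 2 * π * ‖G‖ ≤ ‖Vc‖ + K * x * Real.log x * (1 / T₃ + 1 / T₃) := hmain
    _ ≤ 2 * π * ‖Res‖ + ‖Vh‖ + (‖Bot‖ + ‖Top‖) + K * x * Real.log x * (1 / T₃ + 1 / T₃) := by
        linarith
    _ ≤ 2 * π * (x / Real.sqrt (1 + t ^ 2)) +
        x ^ (1 / 2 : ℝ) * (∫ y in (-T₃)..T₃, ‖riemannZeta (((1 / 2 : ℝ) : ℂ) + y * I + t * I)‖ /
          ‖((1 / 2 : ℝ) : ℂ) + y * I‖) +
        2 * ((31 * Θ ^ (1 / 2 : ℝ) * (1 + Real.log Θ) * (Real.exp 1 * x) / T₃) * (3 / 2)) +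
        2 * K * x * Real.log x / T₃ := by
        rw [hRes_norm]
        have hB : ‖Bot‖ ≤ (31 * Θ ^ (1 / 2 : ℝ) * (1 + Real.log Θ) * (Real.exp 1 * x) / T₃) * (3 / 2) := by
          rw [← hxb]; exact hBot_norm.trans (mul_le_mul_of_nonneg_left hcabs hH0)
        have hT : ‖Top‖ ≤ (31 * Θ ^ (1 / 2 : ℝ) * (1 + Real.log Θ) * (Real.exp 1 * x) / T₃) * (3 / 2) := by
          rw [← hxb]; exact hTop_norm.trans (mul_le_mul_of_nonneg_left hcabs hH0)
        have hE : K * x * Real.log x * (1 / T₃ + 1 / T₃) = 2 * K * x * Real.log x / T₃ := by ring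
        linarith

/-- `∫_{-T₃}^{T₃} dy/|1/2 + iy| ≤ 4 arsinh T₃ ≤ 4 log(3 T₃)` (`|1/2 + iy| ≥ (1/2)√(1 + y²)`).
[folklore] -/
private theorem integral_inv_norm_le {T₃ : ℝ} (hT₃ : 1 ≤ T₃) :
    ∫ y in (-T₃)..T₃, 1 / ‖((1 / 2 : ℝ) : ℂ) + y * I‖ ≤ 4 * Real.log (3 * T₃) := by
  have hle : -T₃ ≤ T₃ := by linarith
  have hpt : ∀ y : ℝ, 1 / ‖((1 / 2 : ℝ) : ℂ) + y * I‖ ≤ 2 * (Real.sqrt (1 + y ^ 2))⁻¹ := by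
    intro y
    rw [Complex.norm_add_mul_I]
    have h1 : 0 < Real.sqrt ((1 / 2) ^ 2 + y ^ 2) := Real.sqrt_pos.2 (by positivity)
    have h2 : 0 < Real.sqrt (1 + y ^ 2) := Real.sqrt_pos.2 (by positivity)
    have h3 : Real.sqrt (1 + y ^ 2) ≤ 2 * Real.sqrt ((1 / 2) ^ 2 + y ^ 2) := by
      rw [show (2 : ℝ) = Real.sqrt 4 by
          rw [show (4 : ℝ) = 2 ^ 2 by norm_num, Real.sqrt_sq (by norm_num)],
        ← Real.sqrt_mul (by norm_num : (0 : ℝ) ≤ 4)]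
      exact Real.sqrt_le_sqrt (by nlinarith)
    rw [div_le_iff₀ h1]
    calc (1 : ℝ) = (Real.sqrt (1 + y ^ 2))⁻¹ * Real.sqrt (1 + y ^ 2) := by
          rw [inv_mul_cancel₀ h2.ne']
      _ ≤ (Real.sqrt (1 + y ^ 2))⁻¹ * (2 * Real.sqrt ((1 / 2) ^ 2 + y ^ 2)) := by gcongr
      _ = 2 * (Real.sqrt (1 + y ^ 2))⁻¹ * Real.sqrt ((1 / 2) ^ 2 + y ^ 2) := by ring
  have hcont : Continuous fun y : ℝ ↦ 1 / ‖((1 / 2 : ℝ) : ℂ) + y * I‖ := by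
    refine continuous_const.div (by fun_prop) fun y ↦ ?_
    rw [Complex.norm_add_mul_I]
    exact (Real.sqrt_pos.2 (by positivity)).ne'
  have hcont3 : Continuous fun y : ℝ ↦ (Real.sqrt (1 + y ^ 2))⁻¹ :=
    Continuous.inv₀ (by fun_prop) fun y ↦ (Real.sqrt_pos.2 (by positivity)).ne'
  have hcont2 : Continuous fun y : ℝ ↦ 2 * (Real.sqrt (1 + y ^ 2))⁻¹ :=
    continuous_const.mul hcont3
  have hmono : (∫ y in (-T₃)..T₃, 1 / ‖((1 / 2 : ℝ) : ℂ) + y * I‖) ≤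
      ∫ y in (-T₃)..T₃, 2 * (Real.sqrt (1 + y ^ 2))⁻¹ :=
    intervalIntegral.integral_mono_on hle (hcont.intervalIntegrable _ _)
      (hcont2.intervalIntegrable _ _) (fun y _ ↦ hpt y)
  refine hmono.trans ?_
  rw [intervalIntegral.integral_const_mul,
    intervalIntegral.integral_eq_sub_of_hasDerivAt (fun y _ ↦ Real.hasDerivAt_arsinh y)
      (hcont3.intervalIntegrable _ _), Real.arsinh_neg, sub_neg_eq_add, ← two_mul]
  have harsinh : Real.arsinh T₃ ≤ Real.log (3 * T₃) := by
    rw [Real.arsinh]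
    refine Real.log_le_log (by positivity) ?_
    have : Real.sqrt (1 + T₃ ^ 2) ≤ 2 * T₃ := by
      rw [Real.sqrt_le_left (by positivity)]
      nlinarith
    linarith
  linarith

/-! ## §7. Assembly: the discrete mean square of `∑_{n ≤ L} n^{-it}` over well-spaced points -/

/-- Weighted Cauchy–Schwarz on an interval: `(∫_a^b ψ/φ)² ≤ (∫_a^b 1/φ)(∫_a^b ψ²/φ)` for continuous
`ψ ≥ 0`, `φ > 0` (from the tree's `ZetaM4D.integral_mul_sq_le`). [folklore] -/
private theorem sq_integral_div_le {a b : ℝ} (hab : a ≤ b) {ψ φ : ℝ → ℝ} (hψ : Continuous ψ)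
    (hφ : Continuous φ) (hψ0 : ∀ y, 0 ≤ ψ y) (hφ0 : ∀ y, 0 < φ y) :
    (∫ y in a..b, ψ y / φ y) ^ 2 ≤ (∫ y in a..b, 1 / φ y) * ∫ y in a..b, ψ y ^ 2 / φ y := by
  set ρ : ℝ → ℝ := (Set.Ioc a b).indicator (fun y ↦ 1 / φ y) with hρ
  have hρ0 : ∀ y, 0 ≤ ρ y := fun y ↦ Set.indicator_nonneg (fun y _ ↦ by
    have := hφ0 y; positivity) y
  have hcinv : Continuous fun y ↦ 1 / φ y := continuous_const.div hφ fun y ↦ (hφ0 y).ne'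
  have hint : ∀ {F : ℝ → ℝ}, Continuous F → Integrable ((Set.Ioc a b).indicator F) := by
    intro F hF
    rw [integrable_indicator_iff measurableSet_Ioc]
    exact (hF.continuousOn.integrableOn_Icc).mono_set Set.Ioc_subset_Icc_self
  have hρi : Integrable ρ := hint hcinv
  have hρg_eq : (fun y ↦ ρ y * ψ y) = (Set.Ioc a b).indicator (fun y ↦ 1 / φ y * ψ y) := by
    funext y; rw [hρ, Set.indicator_mul_left]
  have hρg2_eq : (fun y ↦ ρ y * ψ y ^ 2) = (Set.Ioc a b).indicator (fun y ↦ 1 / φ y * ψ y ^ 2) := by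
    funext y; rw [hρ, Set.indicator_mul_left (f := fun y ↦ 1 / φ y) (g := fun y ↦ ψ y ^ 2)]
  have hρg : Integrable fun y ↦ ρ y * ψ y := by rw [hρg_eq]; exact hint (hcinv.mul hψ)
  have hρg2 : Integrable fun y ↦ ρ y * ψ y ^ 2 := by
    rw [hρg2_eq]; exact hint (hcinv.mul (hψ.pow 2))
  have key := ZetaM4D.integral_mul_sq_le hρ0 hψ0 hρi hρg hρg2
  have e1 : (∫ y, ρ y * ψ y) = ∫ y in a..b, ψ y / φ y := by
    rw [hρg_eq, MeasureTheory.integral_indicator measurableSet_Ioc, intervalIntegral.integral_of_le hab]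
    refine MeasureTheory.setIntegral_congr_fun measurableSet_Ioc fun y _ ↦ ?_
    ring
  have e2 : (∫ y, ρ y) = ∫ y in a..b, 1 / φ y := by
    rw [hρ, MeasureTheory.integral_indicator measurableSet_Ioc, intervalIntegral.integral_of_le hab]
  have e3 : (∫ y, ρ y * ψ y ^ 2) = ∫ y in a..b, ψ y ^ 2 / φ y := by
    rw [hρg2_eq, MeasureTheory.integral_indicator measurableSet_Ioc, intervalIntegral.integral_of_le hab]
    refine MeasureTheory.setIntegral_congr_fun measurableSet_Ioc fun y _ ↦ ?_
    ring
  rw [e1, e2, e3] at key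
  exact key

/-- The trivial bound `|∑_{n ≤ L} n^{-it}| ≤ L`. [folklore] -/
private theorem norm_zetaSum_le_length (L : ℕ) (t : ℝ) :
    ‖∑ n ∈ Finset.Icc 1 L, (n : ℂ) ^ (-((t : ℂ) * I))‖ ≤ L := by
  refine (norm_sum_le _ _).trans ?_
  calc ∑ n ∈ Finset.Icc 1 L, ‖(n : ℂ) ^ (-((t : ℂ) * I))‖
      ≤ ∑ _n ∈ Finset.Icc 1 L, (1 : ℝ) := Finset.sum_le_sum fun n _ ↦ norm_natCast_cpow_neg_mul_I_le n t
    _ = L := by simp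

/-- **Regime `L ≥ T`** (long sums): from the van der Corput bound for the kernel
`G(τ) = ∑_{n≤L} n^{-iτ}` (`HalaszMontgomery.norm_kernel_le_vdc_abs`: `|G(τ)| ≤ 1 + 72√|τ|(log|τ|/log 2
+ 1) + 101 L/|τ|` for `|τ| ≥ 1`) and `∑_t 1/(1+t²) ≤ 8`:
`∑_{t∈𝒯} |G(t)|² ≤ 2 600 000 · L² log² T` for `2 ≤ T ≤ L` — the case `N ≥ T` of Jutila's (2.2)
for `q = 1` in the `σ = 0` normalisation ("if `N ≥ qT²`, then (2.2) follows from the well-known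
estimate `≪ (N + RTq) log qT`", p. 59; here even `N ≥ T` suffices, by van der Corput).
[cite: Jutila1977, Lemma 3, (2.2) (case q = 1, N ≥ T), p. 59] -/
theorem sum_norm_sq_zetaSum_le_of_ge (L : ℕ) {T : ℝ} (hT : 2 ≤ T) (hLT : T ≤ (L : ℝ))
    (𝒯 : Finset ℝ) (h𝒯 : ∀ t ∈ 𝒯, |t| ≤ T)
    (hsep : ∀ t ∈ 𝒯, ∀ t' ∈ 𝒯, t ≠ t' → 1 ≤ |t - t'|) :
    ∑ t ∈ 𝒯, ‖∑ n ∈ Finset.Icc 1 L, (n : ℂ) ^ (-((t : ℂ) * I))‖ ^ 2 ≤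
      2600000 * (L : ℝ) ^ 2 * Real.log T ^ 2 := by
  set ℓ := Real.log T with hℓ
  have hℓ2 : 1 / 2 < ℓ := by
    have h := Real.log_two_gt_d9
    have : Real.log 2 ≤ ℓ := Real.log_le_log (by norm_num) hT
    linarith
  have hlog2 : 1 / 2 < Real.log 2 := by have := Real.log_two_gt_d9; linarith
  have hT0 : 0 < T := by linarith
  have hT1 : 1 ≤ T := by linarith
  have hL0 : (0 : ℝ) ≤ L := Nat.cast_nonneg L
  have hsqT : 1 ≤ Real.sqrt T := by rw [show (1:ℝ) = Real.sqrt 1 by simp]; exact Real.sqrt_le_sqrt hT1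
  -- the uniform constant `A = 1 + 72 √T (ℓ/log 2 + 1) ≤ 290 √T ℓ`
  set A : ℝ := 1 + 72 * Real.sqrt T * (ℓ / Real.log 2 + 1) with hA
  have hA0 : 0 ≤ A := by positivity
  have hAle : A ≤ 290 * Real.sqrt T * ℓ := by
    have h1 : ℓ / Real.log 2 + 1 ≤ 4 * ℓ := by
      rw [div_add_one (by linarith), div_le_iff₀ (by linarith)]
      nlinarith
    have h2 : (1 : ℝ) ≤ 2 * Real.sqrt T * ℓ := by nlinarith
    rw [hA]; nlinarith [mul_le_mul_of_nonneg_left h1 (by positivity : (0:ℝ) ≤ 72 * Real.sqrt T)]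
  -- card
  have hR : (#𝒯 : ℝ) ≤ 2 * T + 2 := ZetaM4D.card_le_of_sep 𝒯 hT0.le h𝒯 hsep
  -- pointwise bound
  have hpt : ∀ t ∈ 𝒯, ‖∑ n ∈ Finset.Icc 1 L, (n : ℂ) ^ (-((t : ℂ) * I))‖ ^ 2 ≤
      2 * A ^ 2 + 41000 * (L : ℝ) ^ 2 * (1 / (1 + t ^ 2)) := by
    intro t ht
    rcases lt_or_ge |t| 1 with h1 | h1
    · -- short: |G| ≤ L and 1/(1+t²) ≥ 1/2
      have hG := norm_zetaSum_le_length L t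
      have ht2 : t ^ 2 < 1 := by
        have := abs_lt.1 h1; nlinarith
      have h3 : (1 : ℝ) / 2 ≤ 1 / (1 + t ^ 2) := by
        rw [div_le_div_iff₀ (by norm_num) (by positivity)]; linarith
      have hG2 : ‖∑ n ∈ Finset.Icc 1 L, (n : ℂ) ^ (-((t : ℂ) * I))‖ ^ 2 ≤ (L : ℝ) ^ 2 :=
        pow_le_pow_left₀ (norm_nonneg _) hG 2
      nlinarith [sq_nonneg A]
    · -- long: van der Corput
      have hker := HalaszMontgomery.norm_kernel_le_vdc_abs h1 L
      have hGdef : HalaszMontgomery.kernel L t = ∑ n ∈ Finset.Icc 1 L, (n : ℂ) ^ (-((t : ℂ) * I)) := rfl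
      rw [hGdef] at hker
      have htT : |t| ≤ T := h𝒯 t ht
      have ht0 : 0 < |t| := by linarith
      have hmono : 1 + 72 * Real.sqrt |t| * (Real.log |t| / Real.log 2 + 1) ≤ A := by
        rw [hA]
        have e1 : Real.sqrt |t| ≤ Real.sqrt T := Real.sqrt_le_sqrt htT
        have e2 : Real.log |t| / Real.log 2 + 1 ≤ ℓ / Real.log 2 + 1 := by
          have := Real.log_le_log ht0 htT
          gcongr
        have e3 : 0 ≤ Real.log |t| / Real.log 2 + 1 := by
          have := Real.log_nonneg h1; positivity
        gcongr
      have hG : ‖∑ n ∈ Finset.Icc 1 L, (n : ℂ) ^ (-((t : ℂ) * I))‖ ≤ A + 101 * L / |t| := by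
        linarith
      have hG0 : 0 ≤ ‖∑ n ∈ Finset.Icc 1 L, (n : ℂ) ^ (-((t : ℂ) * I))‖ := norm_nonneg _
      have hsq : ‖∑ n ∈ Finset.Icc 1 L, (n : ℂ) ^ (-((t : ℂ) * I))‖ ^ 2 ≤
          2 * A ^ 2 + 2 * (101 * L / |t|) ^ 2 := by
        have := pow_le_pow_left₀ hG0 hG 2
        nlinarith [sq_nonneg (A - 101 * L / |t|)]
      have hinv : (101 * L / |t|) ^ 2 ≤ 101 ^ 2 * (L : ℝ) ^ 2 * (2 * (1 / (1 + t ^ 2))) := by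
        rw [div_pow, mul_pow, sq_abs]
        have ht2 : 1 ≤ t ^ 2 := by nlinarith [abs_nonneg t, sq_abs t]
        rw [div_le_iff₀ (by positivity)]
        have : (101 : ℝ) ^ 2 * (L : ℝ) ^ 2 * (2 * (1 / (1 + t ^ 2))) * t ^ 2 =
            101 ^ 2 * (L : ℝ) ^ 2 * (2 * t ^ 2 / (1 + t ^ 2)) := by ring
        rw [this]
        have h4 : (1 : ℝ) ≤ 2 * t ^ 2 / (1 + t ^ 2) := by
          rw [le_div_iff₀ (by positivity)]; linarith
        nlinarith [sq_nonneg (L : ℝ)]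
      nlinarith
  -- sum
  have hsum1 := sum_inv_one_add_sq_le 𝒯 hsep
  calc ∑ t ∈ 𝒯, ‖∑ n ∈ Finset.Icc 1 L, (n : ℂ) ^ (-((t : ℂ) * I))‖ ^ 2
      ≤ ∑ t ∈ 𝒯, (2 * A ^ 2 + 41000 * (L : ℝ) ^ 2 * (1 / (1 + t ^ 2))) := Finset.sum_le_sum hpt
    _ = #𝒯 * (2 * A ^ 2) + 41000 * (L : ℝ) ^ 2 * ∑ t ∈ 𝒯, 1 / (1 + t ^ 2) := by
        rw [Finset.sum_add_distrib, Finset.sum_const, nsmul_eq_mul, Finset.mul_sum]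
    _ ≤ (2 * T + 2) * (2 * (290 * Real.sqrt T * ℓ) ^ 2) + 41000 * (L : ℝ) ^ 2 * 8 := by
        gcongr
    _ = (2 * T + 2) * (2 * 290 ^ 2 * T * ℓ ^ 2) + 328000 * (L : ℝ) ^ 2 := by
        rw [mul_pow, mul_pow, Real.sq_sqrt hT0.le]; ring
    _ ≤ 3 * T * (2 * 290 ^ 2 * T * ℓ ^ 2) + 328000 * (L : ℝ) ^ 2 * (2 * ℓ) ^ 2 := by
        have h1 : 2 * T + 2 ≤ 3 * T := by linarith
        have h2 : (1 : ℝ) ≤ (2 * ℓ) ^ 2 := by nlinarith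
        have h3 : 0 ≤ 2 * 290 ^ 2 * T * ℓ ^ 2 := by positivity
        nlinarith [sq_nonneg (L : ℝ)]
    _ ≤ 2600000 * (L : ℝ) ^ 2 * ℓ ^ 2 := by
        have hT2 : T ^ 2 ≤ (L : ℝ) ^ 2 := pow_le_pow_left₀ hT0.le hLT 2
        nlinarith [sq_nonneg ℓ]

/-- **Trivial regime**: `∑_{t∈𝒯} |∑_{n≤L} n^{-it}|² ≤ #𝒯 · L² ≤ √3 L² √(#𝒯 · T)` (using `#𝒯 ≤ 3T`).
[folklore] -/
private theorem sum_norm_sq_zetaSum_le_trivial (L : ℕ) {T : ℝ} (hT : 2 ≤ T) (𝒯 : Finset ℝ)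
    (h𝒯 : ∀ t ∈ 𝒯, |t| ≤ T) (hsep : ∀ t ∈ 𝒯, ∀ t' ∈ 𝒯, t ≠ t' → 1 ≤ |t - t'|) :
    ∑ t ∈ 𝒯, ‖∑ n ∈ Finset.Icc 1 L, (n : ℂ) ^ (-((t : ℂ) * I))‖ ^ 2 ≤
      2 * (L : ℝ) ^ 2 * Real.sqrt (#𝒯 * T) := by
  have hT0 : 0 < T := by linarith
  have hR : (#𝒯 : ℝ) ≤ 2 * T + 2 := ZetaM4D.card_le_of_sep 𝒯 hT0.le h𝒯 hsep
  have hR3 : (#𝒯 : ℝ) ≤ 3 * T := by linarith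
  have hR0 : (0 : ℝ) ≤ #𝒯 := Nat.cast_nonneg _
  have hRle : (#𝒯 : ℝ) ≤ 2 * Real.sqrt (#𝒯 * T) := by
    have h1 : (#𝒯 : ℝ) ^ 2 ≤ (2 * Real.sqrt (#𝒯 * T)) ^ 2 := by
      rw [mul_pow, Real.sq_sqrt (by positivity)]; nlinarith
    nlinarith [Real.sqrt_nonneg (#𝒯 * T), sq_nonneg ((#𝒯 : ℝ) - 2 * Real.sqrt (#𝒯 * T))]
  calc ∑ t ∈ 𝒯, ‖∑ n ∈ Finset.Icc 1 L, (n : ℂ) ^ (-((t : ℂ) * I))‖ ^ 2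
      ≤ ∑ _t ∈ 𝒯, (L : ℝ) ^ 2 :=
        Finset.sum_le_sum fun t _ ↦ pow_le_pow_left₀ (norm_nonneg _) (norm_zetaSum_le_length L t) 2
    _ = #𝒯 * (L : ℝ) ^ 2 := by rw [Finset.sum_const, nsmul_eq_mul]
    _ ≤ 2 * Real.sqrt (#𝒯 * T) * (L : ℝ) ^ 2 := by gcongr
    _ = 2 * (L : ℝ) ^ 2 * Real.sqrt (#𝒯 * T) := by ring


/-- Continuity of `y ↦ ζ(1/2 + iy + it)`. [folklore] -/
private theorem continuous_zeta_half_line (t : ℝ) :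
    Continuous fun y : ℝ ↦ riemannZeta (((1 / 2 : ℝ) : ℂ) + y * I + t * I) := by
  refine continuous_iff_continuousAt.2 fun y ↦ ?_
  have hne : (((1 / 2 : ℝ) : ℂ) + y * I + t * I) ≠ 1 := by
    intro h; have := congrArg Complex.re h; norm_num at this
  exact ContinuousAt.comp (f := fun y : ℝ ↦ (((1 / 2 : ℝ) : ℂ) + y * I + t * I))
    (differentiableAt_riemannZeta hne).continuousAt
    (by fun_prop : Continuous fun y : ℝ ↦ (((1 / 2 : ℝ) : ℂ) + y * I + t * I)).continuousAt

/-- Positivity and continuity of `y ↦ |1/2 + iy|`. [folklore] -/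
private theorem norm_half_add_pos (y : ℝ) : 0 < ‖((1 / 2 : ℝ) : ℂ) + y * I‖ := by
  rw [Complex.norm_add_mul_I]; exact Real.sqrt_pos.2 (by positivity)

/-- Elementary facts for `T ≥ 2`. [folklore] -/
private theorem T_facts {T : ℝ} (hT : 2 ≤ T) :
    2 * T + 3 ≤ T ^ 3 ∧ 3 * (T + 3) ≤ T ^ 4 ∧ T + 1 / 2 ≤ T ^ 2 ∧ 2 * T + 3 ≤ 4 * T := by
  refine ⟨?_, ?_, ?_, by linarith⟩
  · nlinarith [mul_nonneg (sub_nonneg.2 hT) (by positivity : (0:ℝ) ≤ T ^ 2 + 2 * T + 2)]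
  · nlinarith [mul_nonneg (sub_nonneg.2 hT) (by positivity : (0:ℝ) ≤ T ^ 3 + 2 * T ^ 2 + 4 * T + 5)]
  · nlinarith [mul_nonneg (sub_nonneg.2 hT) (by linarith : (0:ℝ) ≤ T + 1)]

set_option maxHeartbeats 400000 in -- long but elementary real arithmetic
/-- **The numerics of the Perron regime** (pure real arithmetic, isolated from the analysis): with
`x = L + 1/2`, `ℓ = log T`, `3 ≤ L < T`, `0 ≤ R ≤ 3T`, `0 ≤ Λ ≤ 4 log(3(T+3))`, the quantity
`3(8x² + (x/4π²)·Λ²·√(R·M₄) + R·E²)` produced by the analysis is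
`≤ C(K, C₄)·(L² ℓ² + L √(RT) ℓ⁵)`. [folklore] -/
private theorem regime3_numerics {K C₄ T L R Λ x ℓ : ℝ} (hK : 0 < K) (hC₄ : 0 ≤ C₄) (hT : 2 ≤ T)
    (hL3 : 3 ≤ L) (hLT : L < T) (hR0 : 0 ≤ R) (hR3 : R ≤ 3 * T) (hx : x = L + 1 / 2)
    (hℓ : ℓ = Real.log T) (hΛ0 : 0 ≤ Λ) (hΛ : Λ ≤ 4 * Real.log (3 * (T + 3))) :
    3 * (x ^ 2 * 8 + x / (4 * π ^ 2) *
      (Λ * (Real.sqrt (R * (C₄ * (T + (T + 3)) * Real.log (T + (T + 3)) ^ 5 + 2 * 16 ^ 4)) * Λ)) +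
      R * ((((31 * (2 * T + 3) ^ (1 / 2 : ℝ) * (1 + Real.log (2 * T + 3)) * (Real.exp 1 * x) /
        (T + 3)) * (3 / 2)) + K * x * Real.log x / (T + 3)) / π) ^ 2) ≤
    3 * (128 + 12 * (1395 + 2 * K) ^ 2 + 27 * Real.sqrt (851 * C₄ + 2097152)) *
      (L ^ 2 * ℓ ^ 2 + L * Real.sqrt (R * T) * ℓ ^ 5) := by
  obtain ⟨hT3, hT4, hT2, hT4'⟩ := T_facts hT
  set T₃ : ℝ := T + 3 with hT₃
  set Θ : ℝ := 2 * T + 3 with hΘ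
  set C₅ : ℝ := 851 * C₄ + 2097152 with hC₅
  set CE : ℝ := 1395 + 2 * K with hCE
  set M₄ : ℝ := C₄ * (T + T₃) * Real.log (T + T₃) ^ 5 + 2 * 16 ^ 4 with hM₄
  set Hb : ℝ := (31 * Θ ^ (1 / 2 : ℝ) * (1 + Real.log Θ) * (Real.exp 1 * x) / T₃) * (3 / 2) with hHb
  set E : ℝ := (Hb + K * x * Real.log x / T₃) / π with hE
  have hC₅0 : 0 ≤ C₅ := by positivity
  have hCE0 : 0 ≤ CE := by positivity
  have hT0 : 0 < T := by linarith
  have hT1 : (1 : ℝ) ≤ T := by linarith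
  have hL0 : 0 ≤ L := by linarith
  have hx0 : 0 < x := by rw [hx]; linarith
  have hx1 : 1 ≤ x := by rw [hx]; linarith
  have hxL : x ≤ 2 * L := by rw [hx]; linarith
  have hℓ2 : 1 / 2 < ℓ := by
    have h := Real.log_two_gt_d9
    have : Real.log 2 ≤ ℓ := by rw [hℓ]; exact Real.log_le_log (by norm_num) hT
    linarith
  have hℓ0 : 0 < ℓ := by linarith
  have hlogx : Real.log x ≤ 2 * ℓ := by
    have hxT : x ≤ T ^ 2 := by rw [hx]; linarith
    calc Real.log x ≤ Real.log (T ^ 2) := Real.log_le_log hx0 hxT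
      _ = 2 * ℓ := by rw [Real.log_pow, hℓ]; push_cast; ring
  have hlogx0 : 0 ≤ Real.log x := Real.log_nonneg hx1
  have hsqT : 0 < Real.sqrt T := Real.sqrt_pos.2 hT0
  have hsqTT : Real.sqrt T ≤ T := by nlinarith [Real.sq_sqrt hT0.le, Real.sqrt_nonneg T]
  have hT₃T : T ≤ T₃ := by rw [hT₃]; linarith
  have hT₃0 : 0 < T₃ := by linarith
  have hΘ1 : 1 ≤ Θ := by rw [hΘ]; linarith
  have hΘlog0 : 0 ≤ 1 + Real.log Θ := by have := Real.log_nonneg hΘ1; linarith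
  have hΘsq : Θ ^ (1 / 2 : ℝ) ≤ 2 * Real.sqrt T := by
    calc Θ ^ (1 / 2 : ℝ) ≤ (4 * T) ^ (1 / 2 : ℝ) :=
          Real.rpow_le_rpow (by linarith) hT4' (by norm_num)
      _ = Real.sqrt (4 * T) := (Real.sqrt_eq_rpow (4 * T)).symm
      _ = 2 * Real.sqrt T := by
          rw [Real.sqrt_mul (by norm_num), show (4:ℝ) = 2 ^ 2 by norm_num,
            Real.sqrt_sq (by norm_num)]
  have hΘlog : 1 + Real.log Θ ≤ 5 * ℓ := by
    have h2 : Real.log Θ ≤ 3 * ℓ := by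
      calc Real.log Θ ≤ Real.log (T ^ 3) := Real.log_le_log (by linarith) hT3
        _ = 3 * ℓ := by rw [Real.log_pow, hℓ]; push_cast; ring
    linarith
  have he3 : Real.exp 1 ≤ 3 := by have := Real.exp_one_lt_d9; linarith
  have hHb_le : Hb ≤ 1395 * x * ℓ / Real.sqrt T := by
    have h1 : 31 * Θ ^ (1 / 2 : ℝ) * (1 + Real.log Θ) * (Real.exp 1 * x) ≤
        31 * (2 * Real.sqrt T) * (5 * ℓ) * (3 * x) := by gcongr
    have h2 : 31 * Θ ^ (1 / 2 : ℝ) * (1 + Real.log Θ) * (Real.exp 1 * x) / T₃ ≤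
        31 * (2 * Real.sqrt T) * (5 * ℓ) * (3 * x) / T :=
      div_le_div₀ (by positivity) h1 hT0 hT₃T
    have h3 : 31 * (2 * Real.sqrt T) * (5 * ℓ) * (3 * x) / T = 930 * x * ℓ / Real.sqrt T := by
      rw [div_eq_div_iff hT0.ne' hsqT.ne']
      linear_combination (930 * x * ℓ) * Real.mul_self_sqrt hT0.le
    rw [hHb]
    calc 31 * Θ ^ (1 / 2 : ℝ) * (1 + Real.log Θ) * (Real.exp 1 * x) / T₃ * (3 / 2)
        ≤ (930 * x * ℓ / Real.sqrt T) * (3 / 2) :=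
          mul_le_mul_of_nonneg_right (h2.trans h3.le) (by norm_num)
      _ = 1395 * x * ℓ / Real.sqrt T := by ring
  have hKx_le : K * x * Real.log x / T₃ ≤ 2 * K * x * ℓ / Real.sqrt T := by
    have h1 : K * x * Real.log x ≤ 2 * K * x * ℓ := by
      calc K * x * Real.log x ≤ K * x * (2 * ℓ) :=
            mul_le_mul_of_nonneg_left hlogx (mul_pos hK hx0).le
        _ = 2 * K * x * ℓ := by ring
    exact div_le_div₀ (by positivity) h1 hsqT (hsqTT.trans hT₃T)
  have hE_le : E ≤ CE * x * ℓ / Real.sqrt T := by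
    rw [hE, hCE]
    have hπ1 : (1 : ℝ) ≤ π := by have := Real.pi_gt_three; linarith
    have hsum : Hb + K * x * Real.log x / T₃ ≤ (1395 + 2 * K) * x * ℓ / Real.sqrt T := by
      have e : 1395 * x * ℓ / Real.sqrt T + 2 * K * x * ℓ / Real.sqrt T =
          (1395 + 2 * K) * x * ℓ / Real.sqrt T := by ring
      linarith [add_le_add hHb_le hKx_le]
    have h0 : 0 ≤ (1395 + 2 * K) * x * ℓ / Real.sqrt T := by positivity
    calc (Hb + K * x * Real.log x / T₃) / π ≤ ((1395 + 2 * K) * x * ℓ / Real.sqrt T) / π := by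
          gcongr
      _ ≤ (1395 + 2 * K) * x * ℓ / Real.sqrt T := div_le_self h0 hπ1
  have hHb0 : 0 ≤ Hb := by
    rw [hHb]
    have : 0 ≤ Θ ^ (1 / 2 : ℝ) := Real.rpow_nonneg (by linarith) _
    have : 0 ≤ Real.exp 1 * x := by positivity
    apply mul_nonneg _ (by norm_num)
    apply div_nonneg _ hT₃0.le
    apply mul_nonneg (mul_nonneg (mul_nonneg (by norm_num) (by assumption)) hΘlog0) this
  have hE0 : 0 ≤ E := by
    rw [hE]
    have : 0 ≤ K * x * Real.log x / T₃ := by positivity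
    have hπ0 : 0 < π := Real.pi_pos
    positivity
  have hΛ_le : Λ ≤ 16 * ℓ := by
    have h2 : Real.log (3 * (T + 3)) ≤ 4 * ℓ := by
      calc Real.log (3 * (T + 3)) ≤ Real.log (T ^ 4) := Real.log_le_log (by positivity) hT4
        _ = 4 * ℓ := by rw [Real.log_pow, hℓ]; push_cast; ring
    linarith
  -- size of `M₄` and `√(R M₄)`
  have hM₄0 : 0 ≤ M₄ := by
    have : 0 ≤ Real.log (T + T₃) := Real.log_nonneg (by linarith); positivity
  have hM₄_le : M₄ ≤ C₅ * T * ℓ ^ 5 := by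
    have h1 : T + T₃ ≤ 7 / 2 * T := by rw [hT₃]; linarith
    have h2 : Real.log (T + T₃) ≤ 3 * ℓ := by
      have : T + T₃ ≤ T ^ 3 := by rw [hT₃]; linarith
      calc Real.log (T + T₃) ≤ Real.log (T ^ 3) := Real.log_le_log (by linarith) this
        _ = 3 * ℓ := by rw [Real.log_pow, hℓ]; push_cast; ring
    have h2' : 0 ≤ Real.log (T + T₃) := Real.log_nonneg (by linarith)
    have h3 : Real.log (T + T₃) ^ 5 ≤ (3 * ℓ) ^ 5 := pow_le_pow_left₀ h2' h2 5
    have h4 : C₄ * (T + T₃) * Real.log (T + T₃) ^ 5 ≤ C₄ * (7 / 2 * T) * (3 * ℓ) ^ 5 := by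
      gcongr
    have hℓ5 : (1 : ℝ) / 32 ≤ ℓ ^ 5 := by
      have h := pow_le_pow_left₀ (by norm_num : (0:ℝ) ≤ 1 / 2) hℓ2.le 5
      have e : ((1 : ℝ) / 2) ^ 5 = 1 / 32 := by norm_num
      rw [e] at h; exact h
    have h16 : (1 : ℝ) ≤ 16 * T * ℓ ^ 5 := by
      nlinarith only [hT, hℓ5, mul_nonneg (sub_nonneg.2 hT) (sub_nonneg.2 hℓ5)]
    have h5 : (2 : ℝ) * 16 ^ 4 ≤ 2097152 * T * ℓ ^ 5 := by
      have e : (2097152 : ℝ) * T * ℓ ^ 5 = 2 * 16 ^ 4 * (16 * T * ℓ ^ 5) := by ring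
      rw [e]; nlinarith only [h16]
    have h6 : C₄ * (7 / 2 * T) * (3 * ℓ) ^ 5 ≤ 851 * C₄ * T * ℓ ^ 5 := by
      have e : (3 * ℓ) ^ 5 = 243 * ℓ ^ 5 := by ring
      rw [e]
      nlinarith only [mul_nonneg (mul_nonneg hC₄ hT0.le) (pow_pos hℓ0 5).le]
    rw [hM₄, hC₅]; linarith only [h4, h5, h6]
  have hsqrt_le : Real.sqrt (R * M₄) ≤ 2 * Real.sqrt C₅ * Real.sqrt (R * T) * ℓ ^ 3 := by
    have h1 : R * M₄ ≤ (2 * Real.sqrt C₅ * Real.sqrt (R * T) * ℓ ^ 3) ^ 2 := by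
      have e : (2 * Real.sqrt C₅ * Real.sqrt (R * T) * ℓ ^ 3) ^ 2 = 4 * C₅ * (R * T) * ℓ ^ 6 := by
        rw [mul_pow, mul_pow, mul_pow, Real.sq_sqrt hC₅0, Real.sq_sqrt (by positivity)]; ring
      rw [e]
      have h2 : R * M₄ ≤ R * (C₅ * T * ℓ ^ 5) := mul_le_mul_of_nonneg_left hM₄_le hR0
      have h3 : R * (C₅ * T * ℓ ^ 5) ≤ 4 * C₅ * (R * T) * ℓ ^ 6 := by
        have hl : 0 ≤ ℓ ^ 5 * (4 * ℓ - 1) := mul_nonneg (pow_pos hℓ0 5).le (by linarith)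
        nlinarith only [hl, mul_nonneg (mul_nonneg hR0 hC₅0) hT0.le,
          mul_nonneg (mul_nonneg (mul_nonneg hR0 hC₅0) hT0.le) hl]
      linarith only [h2, h3]
    calc Real.sqrt (R * M₄) ≤ Real.sqrt ((2 * Real.sqrt C₅ * Real.sqrt (R * T) * ℓ ^ 3) ^ 2) :=
          Real.sqrt_le_sqrt h1
      _ = 2 * Real.sqrt C₅ * Real.sqrt (R * T) * ℓ ^ 3 := Real.sqrt_sq (by positivity)
  -- the three terms
  have hπ2 : (39 : ℝ) ≤ 4 * π ^ 2 := by nlinarith only [Real.pi_gt_d2, Real.pi_pos]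
  have hE2 : R * E ^ 2 ≤ 3 * CE ^ 2 * x ^ 2 * ℓ ^ 2 := by
    have h1 : E ^ 2 ≤ (CE * x * ℓ / Real.sqrt T) ^ 2 := pow_le_pow_left₀ hE0 hE_le 2
    have h2 : (CE * x * ℓ / Real.sqrt T) ^ 2 = CE ^ 2 * x ^ 2 * ℓ ^ 2 / T := by
      rw [div_pow, Real.sq_sqrt hT0.le]; ring
    rw [h2] at h1
    have h3 : R * (CE ^ 2 * x ^ 2 * ℓ ^ 2 / T) ≤ 3 * T * (CE ^ 2 * x ^ 2 * ℓ ^ 2 / T) :=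
      mul_le_mul_of_nonneg_right hR3 (by positivity)
    have h4 : 3 * T * (CE ^ 2 * x ^ 2 * ℓ ^ 2 / T) = 3 * CE ^ 2 * x ^ 2 * ℓ ^ 2 := by
      field_simp
    calc R * E ^ 2 ≤ R * (CE ^ 2 * x ^ 2 * ℓ ^ 2 / T) := mul_le_mul_of_nonneg_left h1 hR0
      _ ≤ 3 * T * (CE ^ 2 * x ^ 2 * ℓ ^ 2 / T) := h3
      _ = 3 * CE ^ 2 * x ^ 2 * ℓ ^ 2 := h4
  have hmid : x / (4 * π ^ 2) * (Λ * (Real.sqrt (R * M₄) * Λ)) ≤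
      27 * Real.sqrt C₅ * L * Real.sqrt (R * T) * ℓ ^ 5 := by
    have h1 : Λ * (Real.sqrt (R * M₄) * Λ) ≤
        (16 * ℓ) * ((2 * Real.sqrt C₅ * Real.sqrt (R * T) * ℓ ^ 3) * (16 * ℓ)) := by
      have : 0 ≤ Real.sqrt (R * M₄) := Real.sqrt_nonneg _
      gcongr
    have h2 : x / (4 * π ^ 2) ≤ 2 * L / 39 := by
      rw [div_le_div_iff₀ (by positivity) (by norm_num)]
      nlinarith only [hxL, hπ2, hL0, hx0, mul_nonneg hL0 (sub_nonneg.2 hπ2)]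
    have h3 : 0 ≤ Λ * (Real.sqrt (R * M₄) * Λ) := by positivity
    calc x / (4 * π ^ 2) * (Λ * (Real.sqrt (R * M₄) * Λ))
        ≤ (2 * L / 39) * ((16 * ℓ) * ((2 * Real.sqrt C₅ * Real.sqrt (R * T) * ℓ ^ 3) * (16 * ℓ))) :=
          mul_le_mul h2 h1 h3 (by positivity)
      _ = (1024 / 39) * (Real.sqrt C₅ * L * Real.sqrt (R * T) * ℓ ^ 5) := by ring
      _ ≤ 27 * (Real.sqrt C₅ * L * Real.sqrt (R * T) * ℓ ^ 5) :=
          mul_le_mul_of_nonneg_right (by norm_num) (by positivity)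
      _ = 27 * Real.sqrt C₅ * L * Real.sqrt (R * T) * ℓ ^ 5 := by ring
  have hx2 : x ^ 2 ≤ 4 * L ^ 2 := by
    nlinarith only [hxL, hx0, hL0, mul_nonneg hL0 (sub_nonneg.2 hxL)]
  have hℓsq : (1 : ℝ) ≤ 4 * ℓ ^ 2 := by nlinarith only [hℓ2]
  have hL2 : 0 ≤ L ^ 2 := sq_nonneg _
  have hfirst : x ^ 2 * 8 ≤ 128 * L ^ 2 * ℓ ^ 2 := by
    nlinarith only [hx2, hℓsq, hL2, mul_nonneg hL2 (sub_nonneg.2 hℓsq)]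
  have hthird : 3 * CE ^ 2 * x ^ 2 * ℓ ^ 2 ≤ 12 * CE ^ 2 * L ^ 2 * ℓ ^ 2 := by
    have h0 : 0 ≤ 3 * CE ^ 2 * ℓ ^ 2 := by positivity
    linarith only [mul_le_mul_of_nonneg_left hx2 h0]
  have hA0 : 0 ≤ L ^ 2 * ℓ ^ 2 := by positivity
  have hB0 : 0 ≤ L * Real.sqrt (R * T) * ℓ ^ 5 := by positivity
  calc 3 * (x ^ 2 * 8 + x / (4 * π ^ 2) * (Λ * (Real.sqrt (R * M₄) * Λ)) + R * E ^ 2)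
      ≤ 3 * (128 * L ^ 2 * ℓ ^ 2 + 27 * Real.sqrt C₅ * L * Real.sqrt (R * T) * ℓ ^ 5 +
          12 * CE ^ 2 * L ^ 2 * ℓ ^ 2) := by linarith only [hfirst, hmid, hE2, hthird]
    _ ≤ 3 * (128 + 12 * CE ^ 2 + 27 * Real.sqrt C₅) *
          (L ^ 2 * ℓ ^ 2 + L * Real.sqrt (R * T) * ℓ ^ 5) := by
        nlinarith only [mul_nonneg (sq_nonneg CE) hB0, mul_nonneg (Real.sqrt_nonneg C₅) hA0,
          mul_nonneg (by norm_num : (0:ℝ) ≤ 128) hB0, hA0, hB0]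

/-- **The analysis of the Perron regime** (`3 ≤ L < T`): for a constant `K` of
`norm_zetaSum_le_pointwise` and a nonnegative constant `C₄` of the discrete fourth moment,
`∑_{t∈𝒯} |∑_{n≤L} n^{-it}|² ≤ 3(8x² + (x/4π²)Λ²√(R·M₄) + R·E²)` (notation of `regime3_numerics`).
[cite: Jutila1977, proof of Lemma 3, pp. 58–59] -/
theorem regime3_analytic {K C₄ : ℝ} (hK0 : 0 ≤ K)
    (hK : ∀ (L : ℕ), 3 ≤ L → ∀ (t T₃ Θ : ℝ), |t| + 3 ≤ T₃ → T₃ + |t| ≤ Θ →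
      2 * π * ‖∑ n ∈ Finset.Icc 1 L, (n : ℂ) ^ (-((t : ℂ) * I))‖ ≤
        2 * π * (((L : ℝ) + 1 / 2) / Real.sqrt (1 + t ^ 2)) +
        ((L : ℝ) + 1 / 2) ^ (1 / 2 : ℝ) *
          (∫ y in (-T₃)..T₃, ‖riemannZeta (((1 / 2 : ℝ) : ℂ) + y * I + t * I)‖ /
            ‖((1 / 2 : ℝ) : ℂ) + y * I‖) +
        2 * ((31 * Θ ^ (1 / 2 : ℝ) * (1 + Real.log Θ) * (Real.exp 1 * ((L : ℝ) + 1 / 2)) / T₃) *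
          (3 / 2)) +
        2 * K * ((L : ℝ) + 1 / 2) * Real.log ((L : ℝ) + 1 / 2) / T₃)
    (hC₄ : ∀ (T : ℝ) (𝒯 : Finset ℝ), 2 ≤ T →
      (∀ t ∈ 𝒯, 1 ≤ |t| ∧ |t| ≤ T) → (∀ t ∈ 𝒯, ∀ t' ∈ 𝒯, t ≠ t' → 1 ≤ |t - t'|) →
      ∑ t ∈ 𝒯, ‖riemannZeta (1 / 2 + t * I)‖ ^ 4 ≤ C₄ * T * Real.log T ^ 5)
    (L : ℕ) (T : ℝ) (𝒯 : Finset ℝ) (hL : 3 ≤ L) (hT : 2 ≤ T) (h𝒯 : ∀ t ∈ 𝒯, |t| ≤ T)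
    (hsep : ∀ t ∈ 𝒯, ∀ t' ∈ 𝒯, t ≠ t' → 1 ≤ |t - t'|) :
    ∑ t ∈ 𝒯, ‖∑ n ∈ Finset.Icc 1 L, (n : ℂ) ^ (-((t : ℂ) * I))‖ ^ 2 ≤
      3 * (((L : ℝ) + 1 / 2) ^ 2 * 8 + ((L : ℝ) + 1 / 2) / (4 * π ^ 2) *
        ((∫ y in (-(T + 3))..(T + 3), 1 / ‖((1 / 2 : ℝ) : ℂ) + y * I‖) *
          (Real.sqrt (#𝒯 * (C₄ * (T + (T + 3)) * Real.log (T + (T + 3)) ^ 5 + 2 * 16 ^ 4)) *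
            (∫ y in (-(T + 3))..(T + 3), 1 / ‖((1 / 2 : ℝ) : ℂ) + y * I‖))) +
        #𝒯 * ((((31 * (2 * T + 3) ^ (1 / 2 : ℝ) * (1 + Real.log (2 * T + 3)) *
          (Real.exp 1 * ((L : ℝ) + 1 / 2)) / (T + 3)) * (3 / 2)) +
          K * ((L : ℝ) + 1 / 2) * Real.log ((L : ℝ) + 1 / 2) / (T + 3)) / π) ^ 2) := by
  have hT0 : 0 < T := by linarith
  set T₃ : ℝ := T + 3 with hT₃
  set Θ : ℝ := 2 * T + 3 with hΘ
  set Λ : ℝ := ∫ y in (-T₃)..T₃, 1 / ‖((1 / 2 : ℝ) : ℂ) + y * I‖ with hΛ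
  set x : ℝ := (L : ℝ) + 1 / 2 with hx
  set R : ℝ := (#𝒯 : ℝ) with hR
  set M₄ : ℝ := C₄ * (T + T₃) * Real.log (T + T₃) ^ 5 + 2 * 16 ^ 4 with hM₄
  set Hb : ℝ := (31 * Θ ^ (1 / 2 : ℝ) * (1 + Real.log Θ) * (Real.exp 1 * x) / T₃) * (3 / 2) with hHb
  set E : ℝ := (Hb + K * x * Real.log x / T₃) / π with hE
  have hx0 : 0 < x := by positivity
  have hT₃0 : 0 < T₃ := by rw [hT₃]; linarith
  have hΛ0 : 0 ≤ Λ := by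
    rw [hΛ]; exact intervalIntegral.integral_nonneg (by linarith) fun y _ ↦ by
      have := norm_half_add_pos y; positivity
  -- pointwise bound, divided by 2π
  have hpt : ∀ t ∈ 𝒯, ‖∑ n ∈ Finset.Icc 1 L, (n : ℂ) ^ (-((t : ℂ) * I))‖ ≤
      x / Real.sqrt (1 + t ^ 2) + x ^ (1 / 2 : ℝ) / (2 * π) * (∫ y in (-T₃)..T₃, ‖riemannZeta (((1 / 2 : ℝ) : ℂ) + y * I + t * I)‖ / ‖((1 / 2 : ℝ) : ℂ) + y * I‖) + E := by
    intro t ht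
    have htT : |t| ≤ T := h𝒯 t ht
    have h := hK L hL t T₃ Θ (by rw [hT₃]; linarith) (by rw [hΘ, hT₃]; linarith)
    have hπ0 : 0 < 2 * π := by positivity
    rw [← hx] at h
    have hπne : (2 : ℝ) * π ≠ 0 := hπ0.ne'
    have e1 : 2 * π * (x ^ (1 / 2 : ℝ) / (2 * π) * (∫ y in (-T₃)..T₃, ‖riemannZeta (((1 / 2 : ℝ) : ℂ) + y * I + t * I)‖ / ‖((1 / 2 : ℝ) : ℂ) + y * I‖)) = x ^ (1 / 2 : ℝ) * (∫ y in (-T₃)..T₃, ‖riemannZeta (((1 / 2 : ℝ) : ℂ) + y * I + t * I)‖ / ‖((1 / 2 : ℝ) : ℂ) + y * I‖) := by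
      rw [show 2 * π * (x ^ (1 / 2 : ℝ) / (2 * π) * (∫ y in (-T₃)..T₃, ‖riemannZeta (((1 / 2 : ℝ) : ℂ) + y * I + t * I)‖ / ‖((1 / 2 : ℝ) : ℂ) + y * I‖)) =
        (2 * π / (2 * π)) * (x ^ (1 / 2 : ℝ) * (∫ y in (-T₃)..T₃, ‖riemannZeta (((1 / 2 : ℝ) : ℂ) + y * I + t * I)‖ / ‖((1 / 2 : ℝ) : ℂ) + y * I‖)) by ring, div_self hπne, one_mul]
    rw [← hHb] at h
    have e2 : 2 * π * E = 2 * Hb + 2 * K * x * Real.log x / T₃ := by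
      rw [hE]; field_simp
    have : 2 * π * ‖∑ n ∈ Finset.Icc 1 L, (n : ℂ) ^ (-((t : ℂ) * I))‖ ≤
        2 * π * (x / Real.sqrt (1 + t ^ 2) + x ^ (1 / 2 : ℝ) / (2 * π) * (∫ y in (-T₃)..T₃, ‖riemannZeta (((1 / 2 : ℝ) : ℂ) + y * I + t * I)‖ / ‖((1 / 2 : ℝ) : ℂ) + y * I‖) + E) := by
      rw [mul_add, mul_add, e1, e2]
      linarith only [h]
    exact le_of_mul_le_mul_left this hπ0
  have hL3 : (3 : ℝ) ≤ L := by exact_mod_cast hL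
  have hE0 : 0 ≤ E := by
    have hΘlog0 : 0 ≤ 1 + Real.log Θ := by
      have := Real.log_nonneg (show (1:ℝ) ≤ Θ by rw [hΘ]; linarith); linarith
    have hlogx0 : 0 ≤ Real.log x := Real.log_nonneg (by rw [hx]; linarith)
    have hHb0 : 0 ≤ Hb := by
      rw [hHb]
      have h1 : 0 ≤ Θ ^ (1 / 2 : ℝ) := Real.rpow_nonneg (by rw [hΘ]; linarith) _
      have h2 : 0 ≤ Real.exp 1 * x := by positivity
      apply mul_nonneg _ (by norm_num)
      apply div_nonneg _ hT₃0.le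
      exact mul_nonneg (mul_nonneg (mul_nonneg (by norm_num) h1) hΘlog0) h2
    rw [hE]
    have : 0 ≤ K * x * Real.log x / T₃ := by positivity
    have hπ0 : 0 < π := Real.pi_pos
    positivity
  have hsq : ∀ t ∈ 𝒯, ‖∑ n ∈ Finset.Icc 1 L, (n : ℂ) ^ (-((t : ℂ) * I))‖ ^ 2 ≤
      3 * (x ^ 2 * (1 / (1 + t ^ 2)) + x / (4 * π ^ 2) * (∫ y in (-T₃)..T₃, ‖riemannZeta (((1 / 2 : ℝ) : ℂ) + y * I + t * I)‖ / ‖((1 / 2 : ℝ) : ℂ) + y * I‖) ^ 2 + E ^ 2) := by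
    intro t ht
    have h := hpt t ht
    have h0 : 0 ≤ ‖∑ n ∈ Finset.Icc 1 L, (n : ℂ) ^ (-((t : ℂ) * I))‖ := norm_nonneg _
    have h1 := pow_le_pow_left₀ h0 h 2
    set a : ℝ := x / Real.sqrt (1 + t ^ 2) with ha_def
    set b : ℝ := x ^ (1 / 2 : ℝ) / (2 * π) * (∫ y in (-T₃)..T₃, ‖riemannZeta (((1 / 2 : ℝ) : ℂ) + y * I + t * I)‖ / ‖((1 / 2 : ℝ) : ℂ) + y * I‖) with hb_def
    have ha : a ^ 2 = x ^ 2 * (1 / (1 + t ^ 2)) := by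
      rw [ha_def, div_pow, Real.sq_sqrt (by positivity)]; ring
    have hxhalf : (x ^ (1 / 2 : ℝ)) ^ 2 = x := by
      rw [← Real.rpow_natCast, ← Real.rpow_mul hx0.le]; norm_num
    have hb : b ^ 2 = x / (4 * π ^ 2) * (∫ y in (-T₃)..T₃, ‖riemannZeta (((1 / 2 : ℝ) : ℂ) + y * I + t * I)‖ / ‖((1 / 2 : ℝ) : ℂ) + y * I‖) ^ 2 := by
      rw [hb_def, mul_pow, div_pow, hxhalf]; ring
    rw [← ha, ← hb]
    nlinarith only [h1, sq_nonneg (a - b), sq_nonneg (a - E), sq_nonneg (b - E)]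
  -- Cauchy–Schwarz in `y` and the fourth moment
  have hJsq : ∀ t ∈ 𝒯, (∫ y in (-T₃)..T₃, ‖riemannZeta (((1 / 2 : ℝ) : ℂ) + y * I + t * I)‖ / ‖((1 / 2 : ℝ) : ℂ) + y * I‖) ^ 2 ≤ Λ * ∫ y in (-T₃)..T₃, ‖riemannZeta (((1 / 2 : ℝ) : ℂ) + y * I + t * I)‖ ^ 2 / ‖((1 / 2 : ℝ) : ℂ) + y * I‖ := by
    intro t _
    rw [hΛ]
    exact sq_integral_div_le (ψ := fun y ↦ ‖riemannZeta (((1 / 2 : ℝ) : ℂ) + y * I + t * I)‖) (φ := fun y ↦ ‖((1 / 2 : ℝ) : ℂ) + y * I‖) (by linarith)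
      (continuous_zeta_half_line t).norm (by fun_prop) (fun y ↦ norm_nonneg _) norm_half_add_pos
  have hinner : ∑ t ∈ 𝒯, (∫ y in (-T₃)..T₃, ‖riemannZeta (((1 / 2 : ℝ) : ℂ) + y * I + t * I)‖ ^ 2 / ‖((1 / 2 : ℝ) : ℂ) + y * I‖) ≤ Real.sqrt (R * M₄) * Λ := by
    have hcts : ∀ t : ℝ, Continuous fun y : ℝ ↦ ‖riemannZeta (((1 / 2 : ℝ) : ℂ) + y * I + t * I)‖ ^ 2 / ‖((1 / 2 : ℝ) : ℂ) + y * I‖ := fun t ↦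
      ((continuous_zeta_half_line t).norm.pow 2).div (by fun_prop) fun y ↦ (norm_half_add_pos y).ne'
    have hii : ∀ t ∈ 𝒯, IntervalIntegrable (fun y : ℝ ↦ ‖riemannZeta (((1 / 2 : ℝ) : ℂ) + y * I + t * I)‖ ^ 2 / ‖((1 / 2 : ℝ) : ℂ) + y * I‖) volume (-T₃) T₃ :=
      fun t _ ↦ (hcts t).intervalIntegrable _ _
    rw [← intervalIntegral.integral_finsetSum hii]
    have hbd : ∀ y ∈ Set.Icc (-T₃) T₃, ∑ t ∈ 𝒯, ‖riemannZeta (((1 / 2 : ℝ) : ℂ) + y * I + t * I)‖ ^ 2 / ‖((1 / 2 : ℝ) : ℂ) + y * I‖ ≤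
        Real.sqrt (R * M₄) * (1 / ‖((1 / 2 : ℝ) : ℂ) + y * I‖) := by
      intro y hy
      rw [← Finset.sum_div, mul_one_div]
      refine div_le_div_of_nonneg_right ?_ (norm_half_add_pos y).le
      have hy' : |y| ≤ T₃ := abs_le.2 ⟨hy.1, hy.2⟩
      have h := sum_norm_zeta_sq_shift_le hC₄ (T := T) (Y := T₃) (y := y) (by linarith) hy' 𝒯 h𝒯 hsep
      have e : ∀ t : ℝ, riemannZeta (((1 / 2 : ℝ) : ℂ) + y * I + t * I) =
          riemannZeta (1 / 2 + ((t + y : ℝ) : ℂ) * I) := by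
        intro t; congr 1; push_cast; ring
      simp_rw [e]
      rw [hR, hM₄]; exact h
    have hc1 : Continuous fun y : ℝ ↦ ∑ t ∈ 𝒯, ‖riemannZeta (((1 / 2 : ℝ) : ℂ) + y * I + t * I)‖ ^ 2 / ‖((1 / 2 : ℝ) : ℂ) + y * I‖ :=
      continuous_finsetSum _ fun t _ ↦ hcts t
    have hc2 : Continuous fun y : ℝ ↦ Real.sqrt (R * M₄) * (1 / ‖((1 / 2 : ℝ) : ℂ) + y * I‖) :=
      continuous_const.mul (continuous_const.div (by fun_prop) fun y ↦ (norm_half_add_pos y).ne')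
    calc (∫ y in (-T₃)..T₃, ∑ t ∈ 𝒯, ‖riemannZeta (((1 / 2 : ℝ) : ℂ) + y * I + t * I)‖ ^ 2 / ‖((1 / 2 : ℝ) : ℂ) + y * I‖)
        ≤ ∫ y in (-T₃)..T₃, Real.sqrt (R * M₄) * (1 / ‖((1 / 2 : ℝ) : ℂ) + y * I‖) :=
          intervalIntegral.integral_mono_on (by linarith) (hc1.intervalIntegrable _ _)
            (hc2.intervalIntegrable _ _) hbd
      _ = Real.sqrt (R * M₄) * Λ := by rw [intervalIntegral.integral_const_mul, hΛ]
  have hSJ : ∑ t ∈ 𝒯, (∫ y in (-T₃)..T₃, ‖riemannZeta (((1 / 2 : ℝ) : ℂ) + y * I + t * I)‖ / ‖((1 / 2 : ℝ) : ℂ) + y * I‖) ^ 2 ≤ Λ * (Real.sqrt (R * M₄) * Λ) := by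
    calc ∑ t ∈ 𝒯, (∫ y in (-T₃)..T₃, ‖riemannZeta (((1 / 2 : ℝ) : ℂ) + y * I + t * I)‖ / ‖((1 / 2 : ℝ) : ℂ) + y * I‖) ^ 2 ≤ ∑ t ∈ 𝒯, Λ * ∫ y in (-T₃)..T₃, ‖riemannZeta (((1 / 2 : ℝ) : ℂ) + y * I + t * I)‖ ^ 2 / ‖((1 / 2 : ℝ) : ℂ) + y * I‖ :=
          Finset.sum_le_sum hJsq
      _ = Λ * ∑ t ∈ 𝒯, ∫ y in (-T₃)..T₃, ‖riemannZeta (((1 / 2 : ℝ) : ℂ) + y * I + t * I)‖ ^ 2 / ‖((1 / 2 : ℝ) : ℂ) + y * I‖ := by rw [Finset.mul_sum]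
      _ ≤ Λ * (Real.sqrt (R * M₄) * Λ) := mul_le_mul_of_nonneg_left hinner hΛ0
  -- summation
  have hS1 := sum_inv_one_add_sq_le 𝒯 hsep
  have hx2 : 0 ≤ x ^ 2 := sq_nonneg _
  have hxπ : 0 ≤ x / (4 * π ^ 2) := by positivity
  calc ∑ t ∈ 𝒯, ‖∑ n ∈ Finset.Icc 1 L, (n : ℂ) ^ (-((t : ℂ) * I))‖ ^ 2
      ≤ ∑ t ∈ 𝒯, 3 * (x ^ 2 * (1 / (1 + t ^ 2)) + x / (4 * π ^ 2) * (∫ y in (-T₃)..T₃, ‖riemannZeta (((1 / 2 : ℝ) : ℂ) + y * I + t * I)‖ / ‖((1 / 2 : ℝ) : ℂ) + y * I‖) ^ 2 + E ^ 2) :=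
        Finset.sum_le_sum hsq
    _ = 3 * (x ^ 2 * ∑ t ∈ 𝒯, 1 / (1 + t ^ 2) + x / (4 * π ^ 2) * ∑ t ∈ 𝒯, (∫ y in (-T₃)..T₃, ‖riemannZeta (((1 / 2 : ℝ) : ℂ) + y * I + t * I)‖ / ‖((1 / 2 : ℝ) : ℂ) + y * I‖) ^ 2 +
        R * E ^ 2) := by
        rw [← Finset.mul_sum, Finset.sum_add_distrib, Finset.sum_add_distrib, Finset.mul_sum,
          Finset.mul_sum, Finset.sum_const, nsmul_eq_mul, hR]
    _ ≤ 3 * (x ^ 2 * 8 + x / (4 * π ^ 2) * (Λ * (Real.sqrt (R * M₄) * Λ)) + R * E ^ 2) := by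
        gcongr

/-- **Regime `3 ≤ L < T`** (the Perron regime): there is an absolute `C` with
`∑_{t∈𝒯} |∑_{n≤L} n^{-it}|² ≤ C (L² log² T + L (#𝒯·T)^{1/2} log⁵ T)` for `1`-separated `𝒯 ⊂ [−T, T]`,
`T ≥ 2`, `3 ≤ L < T`: the analysis `regime3_analytic` followed by `regime3_numerics`.
[cite: Jutila1977, Lemma 3, (2.2) (case `q = 1`), pp. 58–59] -/
theorem sum_norm_sq_zetaSum_le_of_lt : ∃ C : ℝ, 0 ≤ C ∧ ∀ (L : ℕ) (T : ℝ) (𝒯 : Finset ℝ),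
    3 ≤ L → (L : ℝ) < T → 2 ≤ T → (∀ t ∈ 𝒯, |t| ≤ T) →
    (∀ t ∈ 𝒯, ∀ t' ∈ 𝒯, t ≠ t' → 1 ≤ |t - t'|) →
    ∑ t ∈ 𝒯, ‖∑ n ∈ Finset.Icc 1 L, (n : ℂ) ^ (-((t : ℂ) * I))‖ ^ 2 ≤
      C * ((L : ℝ) ^ 2 * Real.log T ^ 2 + L * Real.sqrt (#𝒯 * T) * Real.log T ^ 5) := by
  obtain ⟨K, hK0, hK⟩ := norm_zetaSum_le_pointwise
  obtain ⟨C₄, hC₄⟩ := Huxley1972_fourthMoment_discrete_holds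
  have hC₄' : ∀ (T : ℝ) (𝒯 : Finset ℝ), 2 ≤ T →
      (∀ t ∈ 𝒯, 1 ≤ |t| ∧ |t| ≤ T) → (∀ t ∈ 𝒯, ∀ t' ∈ 𝒯, t ≠ t' → 1 ≤ |t - t'|) →
      ∑ t ∈ 𝒯, ‖riemannZeta (1 / 2 + t * I)‖ ^ 4 ≤ max C₄ 0 * T * Real.log T ^ 5 := by
    intro T 𝒯 hT h1 h2
    refine (hC₄ T 𝒯 hT h1 h2).trans ?_
    have h0 : 0 ≤ T * Real.log T ^ 5 := by
      have := Real.log_nonneg (show (1:ℝ) ≤ T by linarith); positivity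
    nlinarith [le_max_left C₄ 0]
  refine ⟨3 * (128 + 12 * (1395 + 2 * K) ^ 2 + 27 * Real.sqrt (851 * max C₄ 0 + 2097152)),
    by positivity, fun L T 𝒯 hL hLT hT h𝒯 hsep ↦ ?_⟩
  have hT0 : 0 < T := by linarith
  have hA := regime3_analytic hK0.le hK hC₄' L T 𝒯 hL hT h𝒯 hsep
  have hR3 : (#𝒯 : ℝ) ≤ 3 * T := by
    have := ZetaM4D.card_le_of_sep 𝒯 hT0.le h𝒯 hsep; linarith
  have hΛ := integral_inv_norm_le (T₃ := T + 3) (by linarith)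
  have hΛ0 : 0 ≤ ∫ y in (-(T + 3))..(T + 3), 1 / ‖((1 / 2 : ℝ) : ℂ) + y * I‖ :=
    intervalIntegral.integral_nonneg (by linarith) fun y _ ↦ by
      have := norm_half_add_pos y; positivity
  have hN := regime3_numerics (K := K) (C₄ := max C₄ 0) (T := T) (L := (L : ℝ)) (R := (#𝒯 : ℝ))
    (Λ := ∫ y in (-(T + 3))..(T + 3), 1 / ‖((1 / 2 : ℝ) : ℂ) + y * I‖) (x := (L : ℝ) + 1 / 2) (ℓ := Real.log T)
    hK0 (le_max_right _ _) hT (by exact_mod_cast hL) hLT (Nat.cast_nonneg _) hR3 rfl rfl hΛ0 hΛ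
  exact hA.trans hN

/-- **Jutila 1977, Lemma 3, estimate (2.2), case `q = 1` (trivial character), at `σ = 0`.**
Jutila (Acta Arith. 32 (1977), p. 58): "LEMMA 3. Let for each `r = 1, …, R` a real number `t_r`
with `|t_r| ≤ T` (`T ≥ 2`) … be given. Suppose that for `r ≠ s` … `|t_r − t_s| ≥ 1`. Let `N` be
any positive integer. (i) If all the `χ_r` belong to the same modulus `q`, then
`∑_{r=1}^{R} |∑_{n=1}^{N} χ_r(n) n^{−1/2+it_r}|² ≪ (N + (RTq)^{1/2}) log^B(qT)` (2.2)", proved from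
the fourth moment of `L(1/2+it, χ)` ((2.4), "[14], Th. 10.1 and 10.3"). Here, for `q = 1`, in the
`σ = 0` normalisation (the extra factor `N` on the right accounts for the weights `n^{1/2}`; cf.
the referee's AS-PRINTED-INDEX §6 (e)) and with an explicit power of the logarithm:
there is an absolute `C` such that for all `L ≥ 1`, `T ≥ 2` and every `1`-separated finite
`𝒯 ⊂ [−T, T]`,
`∑_{t∈𝒯} |∑_{n=1}^{L} n^{−it}|² ≤ C · L · (L + (#𝒯 · T)^{1/2}) · log⁵ T`.
Proof (three regimes): `L ≥ T` by van der Corput (`sum_norm_sq_zetaSum_le_of_ge`); `L ≤ 2`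
trivially; `3 ≤ L < T` by the truncated Perron formula for `ζ(w + it)`, the shift to `Re w = 1/2`
past the pole `w = 1 − it`, Cauchy–Schwarz in the height and Huxley's discrete fourth moment of
`ζ(1/2 + it)` at the shifted points (`sum_norm_sq_zetaSum_le_of_lt`) — Jutila's own route
("in the case `N < qT²` we may apply (2.4) or its discrete analogue in the integral representation
`∑_{n≤N} χ(n)n^{−1/2+it} = ε(χ)N^{1/2+it}/(1/2+it) + (1/2πi)∫ L(1/2−it+w, χ)N^w w^{−1} dw + O(log qT)`",
p. 59). [cite: Jutila1977, Lemma 3, (2.2) (case q = 1), pp. 58–59] -/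
theorem sum_norm_sq_zetaSum_le : ∃ C : ℝ, 0 ≤ C ∧ ∀ (L : ℕ) (T : ℝ) (𝒯 : Finset ℝ),
    1 ≤ L → 2 ≤ T → (∀ t ∈ 𝒯, |t| ≤ T) → (∀ t ∈ 𝒯, ∀ t' ∈ 𝒯, t ≠ t' → 1 ≤ |t - t'|) →
    ∑ t ∈ 𝒯, ‖∑ n ∈ Finset.Icc 1 L, (n : ℂ) ^ (-((t : ℂ) * I))‖ ^ 2 ≤
      C * L * (L + Real.sqrt (#𝒯 * T)) * Real.log T ^ 5 := by
  obtain ⟨C₃, hC₃0, hC₃⟩ := sum_norm_sq_zetaSum_le_of_lt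
  refine ⟨8 * 2600000 + 128 + 8 * C₃, by positivity, fun L T 𝒯 hL hT h𝒯 hsep ↦ ?_⟩
  set ℓ : ℝ := Real.log T with hℓ
  set S : ℝ := ∑ t ∈ 𝒯, ‖∑ n ∈ Finset.Icc 1 L, (n : ℂ) ^ (-((t : ℂ) * I))‖ ^ 2 with hS
  set B : ℝ := (L : ℝ) * Real.sqrt (#𝒯 * T) with hB
  have hℓ2 : 1 / 2 < ℓ := by
    have h := Real.log_two_gt_d9
    have : Real.log 2 ≤ ℓ := Real.log_le_log (by norm_num) hT
    linarith
  have hℓ0 : 0 < ℓ := by linarith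
  have hL1 : (1 : ℝ) ≤ L := by exact_mod_cast hL
  have hL0 : (0 : ℝ) ≤ L := by linarith
  have hA0 : 0 ≤ (L : ℝ) ^ 2 := sq_nonneg _
  have hB0 : 0 ≤ B := by positivity
  have h2ℓ : (1 : ℝ) ≤ 2 * ℓ := by linarith
  have hℓ3 : (1 : ℝ) ≤ 8 * ℓ ^ 3 := by
    have h := one_le_pow₀ (M₀ := ℝ) h2ℓ (n := 3); ring_nf at h; linarith
  have hℓ5 : (1 : ℝ) ≤ 32 * ℓ ^ 5 := by
    have h := one_le_pow₀ (M₀ := ℝ) h2ℓ (n := 5); ring_nf at h; linarith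
  have h25 : ℓ ^ 2 ≤ 8 * ℓ ^ 5 := by
    nlinarith only [hℓ3, sq_nonneg ℓ, mul_nonneg (sq_nonneg ℓ) (sub_nonneg.2 hℓ3)]
  -- the target, expanded
  have htarget : (8 * 2600000 + 128 + 8 * C₃) * L * (L + Real.sqrt (#𝒯 * T)) * ℓ ^ 5 =
      (8 * 2600000 + 128 + 8 * C₃) * ((L : ℝ) ^ 2 * ℓ ^ 5 + B * ℓ ^ 5) := by rw [hB]; ring
  rw [htarget]
  have hAB0 : 0 ≤ (L : ℝ) ^ 2 * ℓ ^ 5 + B * ℓ ^ 5 := by positivity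
  rcases le_or_gt T (L : ℝ) with hTL | hLT
  · -- regime `L ≥ T`
    have h := sum_norm_sq_zetaSum_le_of_ge L hT hTL 𝒯 h𝒯 hsep
    have h1 : (2600000 : ℝ) * L ^ 2 * ℓ ^ 2 ≤ 2600000 * (L ^ 2 * (8 * ℓ ^ 5)) := by
      nlinarith only [h25, hA0, mul_le_mul_of_nonneg_left h25 hA0]
    nlinarith only [h, h1, hAB0, hC₃0, hB0, pow_pos hℓ0 5, mul_nonneg hB0 (pow_pos hℓ0 5).le,
      mul_nonneg hC₃0 hAB0]
  · rcases le_or_gt L 2 with hL2 | hL3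
    · -- trivial regime `L ≤ 2`
      have h := sum_norm_sq_zetaSum_le_trivial L hT 𝒯 h𝒯 hsep
      have hL2' : (L : ℝ) ≤ 2 := by exact_mod_cast hL2
      have h1 : 2 * (L : ℝ) ^ 2 * Real.sqrt (#𝒯 * T) ≤ 4 * B := by
        rw [hB]
        have : (L : ℝ) ^ 2 ≤ 2 * L := by nlinarith only [hL2', hL0]
        nlinarith only [this, Real.sqrt_nonneg (#𝒯 * T),
          mul_le_mul_of_nonneg_right this (Real.sqrt_nonneg (#𝒯 * T))]
      have h2 : 4 * B ≤ 128 * (B * ℓ ^ 5) := by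
        nlinarith only [hℓ5, hB0, mul_le_mul_of_nonneg_left hℓ5 hB0]
      nlinarith only [h, h1, h2, hAB0, hC₃0, hA0, pow_pos hℓ0 5, mul_nonneg hA0 (pow_pos hℓ0 5).le,
        mul_nonneg hC₃0 hAB0]
    · -- Perron regime `3 ≤ L < T`
      have hL3' : 3 ≤ L := by omega
      have h := hC₃ L T 𝒯 hL3' hLT hT h𝒯 hsep
      have h1 : C₃ * ((L : ℝ) ^ 2 * ℓ ^ 2 + B * ℓ ^ 5) ≤ C₃ * (L ^ 2 * (8 * ℓ ^ 5) + B * ℓ ^ 5) := by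
        apply mul_le_mul_of_nonneg_left _ hC₃0
        nlinarith only [h25, hA0, mul_le_mul_of_nonneg_left h25 hA0]
      rw [hB] at h1 hAB0
      nlinarith only [h, h1, hAB0, hC₃0, pow_pos hℓ0 5, hA0, hB0,
        mul_nonneg hA0 (pow_pos hℓ0 5).le, mul_nonneg hB0 (pow_pos hℓ0 5).le]


end JutilaMeanValue

end Literature.NumberTheory.LFunctions
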